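import Literature.Geometry.Lorentzian.SphericalEinsteinScalar
import Literature.Geometry.Lorentzian.Genericity
import HarnessLib

/-!
# Barrier catalogue `FinalStateConjecture`: naked singularities form from fine-tuned data and are unstable — Christodoulou's instability theorem (Ann. of Math. 149 (1999), Thm. 4.1)
(`Literature/Barriers/FinalStateConjecture/`, D-0021; family `gr`, summit `FinalStateConjecture`;
namespace `Literature.Barriers.FinalStateConjecture`)

Clause (i) of the final state picture — completeness of future null infinity for *generic*
asymptotically flat data, i.e. weak cosmic censorship (`Literature.Geometry.Lorentzian.WeakCosmicCensorship`,
`CosmicCensorship.lean`, stated for Christodoulou-generic data, `IsChristodoulouGeneric … 1`) —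
carries the word "generic" because of two theorems of Christodoulou on the spherically symmetric
Einstein–scalar-field model, which this file records as a two-sided **barrier**:

* *existence of naked singularities from regular (fine-tuned) data*: "In [4] we constructed
  examples of solutions corresponding to regular asymptotically flat initial data which develop
  singularities which are not preceeded by a trapped region but have future light cones
  expanding to infinity. Thus naked singularities do, in fact, occur in the spherical
  gravitational collapse of a scalar field" (Christodoulou, Ann. of Math. 149 (1999), §1,
  p. 184, on Ann. of Math. 140 (1994)); "This showed, for the first time, that one needs the
  word 'generic' in Conjecture 5" (Shlapentokh-Rothman, C. R. Mécanique 353 (2025), §2.3,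
  p. 388); for the Einstein **vacuum** equations without symmetry: "There exists naked
  singularity solutions for the Einstein vacuum equations" (ibid., Thm. 9, after
  Rodnianski–Shlapentokh-Rothman, Ann. of Math. 198 (2023), Thm. 1, and Shlapentokh-Rothman,
  arXiv:2204.09891);
* *instability (non-genericity) of naked singularities*: "in the space of initial conditions
  the subset of initial conditions leading to the formation of naked singularities has, in a
  certain sense, positive codimension, consequently the occurence of naked singularities is an
  unstable phenomenon" (Ann. of Math. 149 (1999), §1, p. 184), made precise by **Theorem 4.1**
  (p. 216): "Consider the exceptional set `E` in the space of initial data `BV ∩ L¹` on the real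
  line. Then for each `ϑ ∈ E` there is a 2-dimensional linear subspace `Π_ϑ` such that
  `(Π_ϑ ∖ {ϑ}) ∩ E = ∅`. Moreover, if `ϑ, ϑ' ∈ E`, then `Π_ϑ ∩ Π_ϑ' = ∅` unless `ϑ` and `ϑ'`
  coincide. We may therefore say that `E` has positive codimension in the space of initial
  data."

## What is formalised, and how

Theorem 4.1 is a short deduction (§4, pp. 214–216) from Theorems 2.1 and 3.1 of the same paper,
the domain-of-dependence property and the definitions of §1; the heavy analysis is in
Theorems 2.1/3.1 (the blue-shift mechanism along the past light cone `C₀⁻` of the first singular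
point `O`, fed into the trapped-surface formation theorem "Theorem*" of CPAM 44 (1991)). The BV
solution theory in which all of this lives (Christodoulou, CPAM 46 (1993), §1) is **not** in the
tree: the v0 model prelude `SphericalEinsteinScalar` has classical solutions only, and
`CosmicCensorship.lean` ("Not stated in v0 (3)") explains why Christodoulou's solutions — whose
`∂ᵥ(rφ)` is only Hölder continuous across `C₀⁻` — are not classical there. This file therefore
proceeds as follows (house pattern of hypothesis structures, cf. `BondiFoliation.IsCanonical` in
`BondiMass.lean`):

* `christodoulouDataSpace` — the linear carrier "`BV ∩ L¹` on the real line": functions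
  `ϑ : ℝ → ℝ` of bounded variation on `ℝ` and integrable (`ϑ = θ|_{t=0}` in the dimensionless
  coordinate `s` of (1.13), §4 p. 214, (4.2)), a `Submodule ℝ (ℝ → ℝ)`; and inside it
  `rightContinuousData` — **Christodoulou's normalisation**, the printed space of initial data:
  "solutions of bounded variation have the property that `θ(t, s)` is at each `t`, in particular
  at `t = 0`, continuous from the right with respect to `s`" (p. 204, proof of Thm. 2.1), so
  that the pointwise value `ϑ(0) = θ₀(0)` entering Theorems 2.1, 3.1, (4.3), (4.8) is that of
  the right-continuous representative. Theorem 4.1 is stated RELATIVE to this class, using the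
  `𝓓`-slot of the prelude's `Literature.Lorentz.HasLinearCodimAtLeast 𝓓 𝓔 m` (`Genericity.lean`):
  perturbed data must again be normalised data.
* `christodoulouH ϑ s = √(s⁻¹ ∫₀ˢ (e^{s'} ϑ(s') − ϑ(0))² ds')` — the functional `h(s)` of
  Theorem 3.1 / (4.4); `christodoulouF f s = s⁻¹ ∫₀ˢ e^{2s'} f(s')² ds'` — the functional of
  condition (4.6) on the second direction (`limsup_{s→0+} √F/g = ∞`).
* `ChristodoulouInstabilityData` — **the printed input of §§1–4 used in the proof of
  Theorem 4.1, as a hypothesis structure**: an exceptional set `E` of normalised data, the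
  predicate "`γ` is unbounded" and the functions `I(t)`, `g(s)` attached to a datum (all
  defined along `C₀⁻`, (2.1), (2.9b), Thm. 3.1), and the second direction `f₂` of p. 215,
  subject to exactly the facts §4 invokes: domain of dependence (data agreeing on `(−∞, 0)`
  have the same `γ`, `I`, `g` and "the same functions `f₁(s), f₂(s)`", pp. 215–216),
  `E ⊆ {γ unbounded}` (definition of `E`, p. 214), `g > 0`, the properties of `f₂`
  (normalised, vanishing on `(−∞, 0]`, condition (4.6)), Theorem 2.1 and Theorem 3.1 (as
  implications "hypotheses ⇒ `ϑ ∉ E`" on normalised data, which is how §4 uses them, `E` being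
  defined by the failure of the conclusion of Theorem 2.1).
* `ChristodoulouInstabilityData.hasLinearCodimAtLeast_two`, `.eq_of_add_dirs_eq`,
  `nakedSingularityInstability` — **Theorem 4.1, both clauses, PROVED** from the structure,
  with the directions `christodoulouDir₁ = f₁ = 𝟙_{[0,1)}` (a normalised BV datum with
  `f₁ = 0` on `(−∞, 0)` and `f₁(0) = 1`, so that `ϑ + λ₁ f₁` has the same interior solution as
  `ϑ` but `(ϑ + λ₁ f₁)(0) = lim I + λ₁`, exactly the role of the printed `f₁`, (4.5), (4.8)) and
  `f₂ = T.dir₂ ϑ` (the structure's direction), following the printed argument (pp. 215–216):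
  for `λ₁ ≠ 0`, Theorem 2.1 applies; for `λ₁ = 0 ≠ λ₂`, "by (4.4) and (4.6)"
  `limsup h̃/g = ∞` and Theorem 3.1 applies; planes through distinct exceptional data are
  disjoint by the same two facts. The analytic step "by (4.4) and (4.6)" is the lemma
  `not_isBoundedUnder_christodoulouH_add` (`h̃(s)² ≥ λ₂² F(s)/2 − h(s)²`, whence a bound on
  `h̃/g` and `h/g` would bound `√F/g`).
* `not_hasOpenSubset_of_hasLinearCodimAtLeast`, `interior_eq_empty_of_hasLinearCodimAtLeast_univ`
  (abstract, any real vector space with a topology making translations and scalar lines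
  continuous) and `ChristodoulouInstabilityData.not_hasOpenSubset`,
  `.interior_exceptionalSet_eq_empty` — **the barrier's bite, PROVED**: an exceptional set of
  positive linear codimension inside `𝓓` contains no nonempty relatively open subset of `𝓓`
  (and has empty interior), in *every* vector topology; so in the model no "open set of
  naked-singularity data" (the shape of the negation summit gr.S03
  `Literature.Geometry.Lorentzian.NegWeakCosmicCensorship`) can exist, and exhibiting naked-singularity solutions does
  not bear on the generic conjecture.

What is NOT vendored (no formal object in the tree asserts it): that Christodoulou's BV theory
instantiates `ChristodoulouInstabilityData` with its physical exceptional set (Theorems 2.1 and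
3.1, the domain of dependence, the existence of the printed `f₂`), and `E ≠ ∅` (Christodoulou
1994); see `scope_caveats` (c) and `status` in the barrier block.

## Audit (D-0021, 2026-08-15): the barrier is a LOW-REGULARITY statement (Part 6)

A barrier audit found both blocked technique classes narrower than their tokens suggest, and
Part 6 records the finding formally (`nakedSingularityInstabilityNarrow`, proved, sorry-free):
(B) the two directions of Theorem 4.1 are rough at `S₀` — `f₁` is discontinuous
(`not_continuousAt_christodoulouDir₁`), and in every instance of the printed input a second
direction obeying (4.6) is never `O(g)` at `S₀` (`ChristodoulouInstabilityData.not_dominated_dir₂`;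
with a power envelope `c·s^p ≤ g`, e.g. the printed `g ≥ s^{1/20}`, never Hölder-`p`,
`.not_holder_dir₂`), because `|f| ≤ L·g` on `(0,s]` forces `F(s) ≤ e²L²g(s)²`
(`isBoundedUnder_sqrt_christodoulouF_of_dominated`); dually every datum with `ϑ(0) = 0`
dominated by `g` satisfies (4.4) (`isBoundedUnder_christodoulouH_of_dominated`), so Theorem 3.1
never fires on it; (C) NON-DESCENT — positive linear codimension relative to the `BV` carrier
says nothing relative to a smoother admissible class: for every positive profile `g` and
admissible `f₂` there is an instance of `ChristodoulouInstabilityData` whose exceptional set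
contains all `g`-dominated normalised data (`exists_instabilityData_forall_dominated_mem`), and
for the concrete pair `(g, f₂) = (s, √s·𝟙_{[0,1)})` (`christodoulouDirSqrt`,
`christodoulouF_dirSqrt_ge`, `not_isBoundedUnder_dirSqrt`) the whole nonzero linear class
`lipschitzConeData` of normalised data Lipschitz at `S₀` lies inside `E`, has codimension `0`
there and is relatively open in every topology — while Theorem 4.1 holds. In print: the
instability needs "rough perturbations that trigger a blue-shift instability … In the smooth
class, both the question of the formation of naked singularities and the question of their
genericity remain open" (Cicortas–Kehle, ARMA 250 (2026), §1.5); above the threshold regularity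
`C^{1,k²/(1−k²)}` of the background, linear waves obey self-similar bounds and the exterior is
nonlinearly asymptotically stable (Singh, arXiv:2402.00062, Thm. 1, Prop. 1.1–1.2), "consistent
with the `k`-self similar singularities being nonlinearly stable to sufficiently regular
perturbations!" (Shlapentokh-Rothman 2025, §2.5); and globally: exterior perturbations vanishing
linearly at the cone sphere, small in a weighted `C¹` norm, again give asymptotically flat BV solutions
with INCOMPLETE `𝓘⁺` (Singh, arXiv:2210.11325 = AHP (2024), Thm. 5 with data (3.33)) — relative to
that Lipschitz-at-`S₀` class the physical exceptional set has nonempty relative interior, the shape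
clause (α) forbids relative to `BV`; below the threshold, instability holds in every Hölder class
(Li, arXiv:2508.07655, Thms. 1.1–1.2). See scope caveats (h)–(i) of the barrier block.

## References

* D. Christodoulou, *The instability of naked singularities in the gravitational collapse of a
  scalar field*, Ann. of Math. 149 (1999) 183–217 = arXiv:math/9901147: §1 (pp. 183–189,
  (1.13), (1.27b)), Thm. 2.1 and Theorem* (pp. 192–193), proof of Thm. 2.1 (p. 204,
  right-continuity), Thm. 3.1 (pp. 213–214), §4 and Thm. 4.1 (pp. 214–216). Key
  `Christodoulou1999instability`.
* D. Christodoulou, *Examples of naked singularity formation in the gravitational collapse of a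
  scalar field*, Ann. of Math. 140 (1994) 607–653 (key `Christodoulou1994`; paywalled, read
  through the restatements RSR §1.1, Thms. 1.1–1.2, and Shlapentokh-Rothman 2025, §2.3).
* D. Christodoulou, CPAM 44 (1991) 339–373 (Theorem*), CPAM 46 (1993) 1131–1220 (BV
  solutions), CQG 16 (1999) A23–A35 (generic formulation). Keys `Christodoulou1991`,
  `Christodoulou1993`, `Christodoulou1999`.
* I. Rodnianski, Y. Shlapentokh-Rothman, *Naked singularities for the Einstein vacuum
  equations: the exterior solution*, Ann. of Math. 198 (2023) 231–391 = arXiv:1912.08478, §1,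
  Def. 1.1, Thm. 1, §1.1 (Thms. 1.1–1.2 [Chr94]); Y. Shlapentokh-Rothman, arXiv:2204.09891
  (interior). Keys `RodnianskiShlapentokhRothman2023`, `ShlapentokhRothman2022`.
* Y. Shlapentokh-Rothman, *Weak cosmic censorship, trapped surfaces, and naked singularities
  for the Einstein vacuum equations*, C. R. Mécanique 353 (2025) 379–410, Conj. 5 (p. 383),
  §2.3–§2.5 (pp. 387–391, Thm. 7), Thm. 9 (p. 397). Key `Shlapentokhrothman2025`.
* J. Liu, J. Li, CMP 363 (2018) 561–578; J. Li, J. Liu, J. Differential Geom. 120 (2022)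
  97–197; X. An, Ann. of Math. 201 (2025) 775–908; J. Singh, arXiv:2402.00062; J. Li,
  arXiv:2508.07655. Keys `LiuLi2018`, `LiLiu2022`, `An2025`, `Singh2024`, `Li2025`.
* J. Singh, *High regularity waves on self-similar naked singularity interiors: decay and the
  role of blue-shift*, arXiv:2402.00062 (2024): p. 3, §1.1 Thm. 1, §1.2 Prop. 1.1–1.2
  (pp. 6–7), §1.4 (pp. 12–13), §1.5 (p. 14). Key `Singh2024`.
* J. Singh, *A construction of approximately self-similar naked singularities for the spherically
  symmetric Einstein-scalar field system*, arXiv:2210.11325 (2022) = Ann. Henri Poincaré (2024):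
  Thms. 1–2 (pp. 3–4), §3.2 (3.25)–(3.35), §3.3 Thms. 4–5 (pp. 26–27), Rem. 3.10. Key `Singh2022`.
* S. Cicortas, C. Kehle, *Discretely self-similar exterior-naked singularities for the
  Einstein-scalar field system*, Arch. Ration. Mech. Anal. 250 (2026) = arXiv:2412.09540:
  Thm. 1, §1.2, §1.3, §1.5. Key `CicortasKehle2026`.
* M. Reiterer, E. Trubowitz, *Choptuik's critical spacetime exists*, Comm. Math. Phys. 368
  (2019) 143–186. Key `ReitererTrubowitz2019`.
-/

noncomputable section

open MeasureTheory Set Filter Topology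
open scoped ENNReal

namespace Literature.Barriers.FinalStateConjecture

open Literature.Geometry.Lorentzian

section Abstract

variable {V : Type*} [AddCommGroup V] [Module ℝ V]

/-- Relative linear codimension (families staying in `𝓓`) implies absolute linear codimension
(forget the admissibility of the family). [folklore] -/
theorem HasLinearCodimAtLeast.of_subset_univ {𝓓 𝓔 : Set V} {m : ℕ}
    (h : HasLinearCodimAtLeast 𝓓 𝓔 m) : HasLinearCodimAtLeast univ 𝓔 m := by
  intro d hd
  obtain ⟨f, hf, -, hfE⟩ := h d hd
  exact ⟨f, hf, fun _ ↦ mem_univ _, hfE⟩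

variable [TopologicalSpace V] [ContinuousAdd V] [ContinuousSMul ℝ V]

/-- **Positive linear codimension excludes open sets of exceptional data (relative form).**
If `𝓔` has linear codimension at least `m ≥ 1` inside the admissible class `𝓓`
(`Literature.Geometry.Lorentzian.HasLinearCodimAtLeast`, Christodoulou's notion, Ann. of Math. 149 (1999),
Thm. 4.1) in a real vector space carrying any topology for which translations and the scalar
lines `c ↦ d + c • f` are continuous, then `𝓔` contains no nonempty relatively open subset of
`𝓓` (`Literature.Geometry.Lorentzian.HasOpenSubset` in the subtype topology of `𝓓` fails): through `d ∈ 𝓔` the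
line `d + c f₁` lies in `𝓓`, avoids `𝓔` for `c ≠ 0`, and enters every neighbourhood of `d`.
This is the formal content of "the occurence of naked singularities is an unstable
phenomenon" (ibid., §1, p. 184) as it bears on open-set negations of weak cosmic censorship
(shape of gr.S03 `Literature.Geometry.Lorentzian.NegWeakCosmicCensorship`). [folklore] -/
theorem not_hasOpenSubset_of_hasLinearCodimAtLeast {𝓓 𝓔 : Set V} {m : ℕ}
    (h : HasLinearCodimAtLeast 𝓓 𝓔 m) (hm : m ≠ 0) :
    ¬ HasOpenSubset {d : 𝓓 | (d : V) ∈ 𝓔} := by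
  rintro ⟨d, hd⟩
  have hdE : (d : V) ∈ 𝓔 := (interior_subset hd : d ∈ {d : 𝓓 | (d : V) ∈ 𝓔})
  obtain ⟨f, -, hfD, hfE⟩ := h d hdE
  obtain ⟨i₀⟩ : Nonempty (Fin m) := ⟨⟨0, Nat.pos_of_ne_zero hm⟩⟩
  rw [mem_interior_iff_mem_nhds, mem_nhds_subtype] at hd
  obtain ⟨u, hu, hut⟩ := hd
  have hcont : Tendsto (fun c : ℝ ↦ (d : V) + c • f i₀) (𝓝 0) (𝓝 (d : V)) := by
    have : Continuous (fun c : ℝ ↦ (d : V) + c • f i₀) := by fun_prop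
    simpa using this.tendsto 0
  have hev : ∀ᶠ c : ℝ in 𝓝[≠] 0, (d : V) + c • f i₀ ∈ u ∧ c ≠ 0 :=
    ((hcont.mono_left nhdsWithin_le_nhds).eventually_mem hu).and self_mem_nhdsWithin
  obtain ⟨c, hcu, hc0⟩ := hev.exists
  have hsum : (d : V) + ∑ i, (Pi.single i₀ c : Fin m → ℝ) i • f i = (d : V) + c • f i₀ := by
    congr 1
    simp [Pi.single_apply, Finset.sum_ite_eq']
  have hmemD : (d : V) + c • f i₀ ∈ 𝓓 := hsum ▸ hfD _
  have hmemE : (d : V) + c • f i₀ ∈ 𝓔 :=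
    (hut (show (⟨_, hmemD⟩ : 𝓓) ∈ Subtype.val ⁻¹' u from hcu) :
      (⟨_, hmemD⟩ : 𝓓) ∈ {d : 𝓓 | (d : V) ∈ 𝓔})
  have hne : (Pi.single i₀ c : Fin m → ℝ) ≠ 0 := by
    intro h0
    have := congr_fun h0 i₀
    simp [hc0] at this
  exact hfE _ hne (hsum ▸ hmemE)

/-- **Positive linear codimension excludes open sets of exceptional data (absolute form):** if
`𝓔` has linear codimension at least `m ≥ 1` in the whole space, then `𝓔` has empty interior in
any topology making translations and scalar lines continuous. [folklore] -/
theorem interior_eq_empty_of_hasLinearCodimAtLeast_univ {𝓔 : Set V} {m : ℕ}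
    (h : HasLinearCodimAtLeast univ 𝓔 m) (hm : m ≠ 0) : interior 𝓔 = ∅ := by
  refine eq_empty_iff_forall_notMem.2 fun d hd ↦ ?_
  have hdE : d ∈ 𝓔 := interior_subset hd
  obtain ⟨f, -, -, hfE⟩ := h d hdE
  obtain ⟨i₀⟩ : Nonempty (Fin m) := ⟨⟨0, Nat.pos_of_ne_zero hm⟩⟩
  rw [mem_interior_iff_mem_nhds] at hd
  have hcont : Tendsto (fun c : ℝ ↦ d + c • f i₀) (𝓝 0) (𝓝 d) := by
    have : Continuous (fun c : ℝ ↦ d + c • f i₀) := by fun_prop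
    simpa using this.tendsto 0
  have hev : ∀ᶠ c : ℝ in 𝓝[≠] 0, d + c • f i₀ ∈ 𝓔 ∧ c ≠ 0 :=
    ((hcont.mono_left nhdsWithin_le_nhds).eventually_mem hd).and self_mem_nhdsWithin
  obtain ⟨c, hcE, hc0⟩ := hev.exists
  have hsum : d + ∑ i, (Pi.single i₀ c : Fin m → ℝ) i • f i = d + c • f i₀ := by
    congr 1
    simp [Pi.single_apply, Finset.sum_ite_eq']
  have hne : (Pi.single i₀ c : Fin m → ℝ) ≠ 0 := by
    intro h0
    have := congr_fun h0 i₀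
    simp [hc0] at this
  exact hfE _ hne (hsum ▸ hcE)

end Abstract

/-! ### Part 2. The normalised direction `𝟙_{[a,b)}`: variation, integrability, right-continuity -/

/-- The indicator `𝟙_{[a, ∞)}` has bounded variation on `ℝ` (monotone with values in `[0, 1]`;
Mathlib's `MonotoneOn.boundedVariationOn`). [folklore] -/
lemma boundedVariationOn_indicator_Ici_one (a : ℝ) :
    BoundedVariationOn ((Ici a).indicator (1 : ℝ → ℝ)) univ := by
  refine MonotoneOn.boundedVariationOn (C := 1) (fun x _ y _ hxy ↦ ?_) fun x _ ↦ ?_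
  · by_cases hx : x ∈ Ici a
    · have hy : y ∈ Ici a := le_trans hx hxy
      simp [hx, hy]
    · simp only [indicator_of_notMem hx]
      exact indicator_nonneg (fun _ _ ↦ zero_le_one) _
  · have h0 : 0 ≤ (Ici a).indicator (1 : ℝ → ℝ) x := indicator_nonneg (fun _ _ ↦ zero_le_one) x
    have h1 : (Ici a).indicator (1 : ℝ → ℝ) x ≤ 1 := indicator_le_self' (fun _ _ ↦ zero_le_one) x
    rw [abs_le]
    exact ⟨by linarith, h1⟩

/-- `𝟙_{[a, b)} = 𝟙_{[a, ∞)} − 𝟙_{[b, ∞)}` for `a ≤ b`. [folklore] -/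
lemma indicator_Ico_eq_sub {a b : ℝ} (hab : a ≤ b) :
    (Ico a b).indicator (1 : ℝ → ℝ) = (Ici a).indicator 1 - (Ici b).indicator 1 := by
  funext x
  by_cases h1 : a ≤ x
  · by_cases h2 : x < b
    · simp [indicator, h1, h2, not_le.2 h2]
    · simp [indicator, h1, h2, not_lt.1 h2]
  · have h2 : ¬ b ≤ x := fun h ↦ h1 (hab.trans h)
    simp [indicator, h1, h2]

/-- The indicator `𝟙_{[a, b)}` has bounded variation on `ℝ`. [folklore] -/
lemma boundedVariationOn_indicator_Ico_one {a b : ℝ} (hab : a ≤ b) :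
    BoundedVariationOn ((Ico a b).indicator (1 : ℝ → ℝ)) univ := by
  rw [indicator_Ico_eq_sub hab, sub_eq_add_neg,
    ← neg_one_smul ℝ ((Ici b).indicator (1 : ℝ → ℝ))]
  exact (boundedVariationOn_indicator_Ici_one a).add
    ((boundedVariationOn_indicator_Ici_one b).const_smul (-1 : ℝ))

/-- The indicator `𝟙_{[a, b)}` is Lebesgue integrable. [folklore] -/
lemma integrable_indicator_Ico_one (a b : ℝ) :
    Integrable ((Ico a b).indicator (1 : ℝ → ℝ)) := by
  rw [integrable_indicator_iff measurableSet_Ico]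
  exact integrableOn_const (by simp)

/-- The indicator `𝟙_{[a, b)}` of a left-closed right-open interval is **continuous from the
right at every point** (it is locally constant on right-neighbourhoods `[x, x + ε)`), i.e. it is a
normalised datum in Christodoulou's sense (Ann. of Math. 149 (1999), p. 204). [folklore] -/
lemma continuousWithinAt_Ici_indicator_Ico_one (a b x : ℝ) :
    ContinuousWithinAt ((Ico a b).indicator (1 : ℝ → ℝ)) (Ici x) x := by
  by_cases hxa : x < a
  · -- locally `0` on `[x, a)`
    have hev : ∀ᶠ y in 𝓝[Ici x] x, (Ico a b).indicator (1 : ℝ → ℝ) y = 0 := by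
      filter_upwards [Ico_mem_nhdsGE hxa] with y hy
      exact indicator_of_notMem (fun h ↦ not_le.2 hy.2 h.1) _
    refine (tendsto_congr' hev).2 ?_
    rw [indicator_of_notMem (fun h ↦ not_le.2 hxa h.1)]
    exact tendsto_const_nhds
  · by_cases hxb : x < b
    · -- `x ∈ [a, b)`: locally `1` on `[x, b)`
      have hxa' : a ≤ x := not_lt.1 hxa
      have hev : ∀ᶠ y in 𝓝[Ici x] x, (Ico a b).indicator (1 : ℝ → ℝ) y = 1 := by
        filter_upwards [Ico_mem_nhdsGE hxb] with y hy
        exact indicator_of_mem (show y ∈ Ico a b from ⟨hxa'.trans hy.1, hy.2⟩) _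
      refine (tendsto_congr' hev).2 ?_
      rw [indicator_of_mem (show x ∈ Ico a b from ⟨hxa', hxb⟩)]
      exact tendsto_const_nhds
    · -- `x ≥ b`: locally `0` on `[x, ∞)`
      have hxb' : b ≤ x := not_lt.1 hxb
      have hev : ∀ᶠ y in 𝓝[Ici x] x, (Ico a b).indicator (1 : ℝ → ℝ) y = 0 := by
        filter_upwards [self_mem_nhdsWithin] with y hy
        exact indicator_of_notMem (fun h ↦ not_lt.2 (hxb'.trans hy) h.2) _
      refine (tendsto_congr' hev).2 ?_
      rw [indicator_of_notMem (fun h ↦ not_lt.2 hxb' h.2)]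
      exact tendsto_const_nhds

/-! ### Part 3. Data space, normalised (right-continuous) data, the direction `f₁` -/

/-- **The linear carrier of the space of initial data of Theorem 4.1**: "the space of initial
data `BV ∩ L¹` on the real line" (Christodoulou, Ann. of Math. 149 (1999), Thm. 4.1, p. 216),
i.e. functions `ϑ : ℝ → ℝ` of bounded variation on all of `ℝ` and Lebesgue integrable. Here
`ϑ = θ|_{t=0}` is the restriction of `θ = r ∂φ/∂r` ((1.4)–(1.5)) to the initial cone `C₀⁺` in
the dimensionless coordinate `s ∈ ℝ` of (1.13) (`u = −2a e^{−t}`, `r = a e^{s−t}`, with `s = 0`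
at the sphere `S₀` where the past light cone `C₀⁻` of the first singular point meets `C₀⁺`,
§1 pp. 186–187), and "`α|_{t=0}` being a function of bounded variation is equivalent to
`θ|_{t=0}` being a function of bounded variation which is integrable on the real line" (§4,
p. 214, (4.1)–(4.2)). It is a real vector subspace of `ℝ → ℝ` (closure under `+` and scalars
by `BoundedVariationOn.add/const_smul` of the `SphericalEinsteinScalar` prelude and
`Integrable.add/smul`). The printed data are moreover NORMALISED (right-continuous):
`rightContinuousData` below; Theorem 4.1 is stated relative to that class.
[cite: Christodoulou1999instability, Thm. 4.1 (p. 216) and §4 (p. 214)] -/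
def christodoulouDataSpace : Submodule ℝ (ℝ → ℝ) where
  carrier := {ϑ | BoundedVariationOn ϑ univ ∧ Integrable ϑ volume}
  add_mem' ha hb := ⟨ha.1.add hb.1, ha.2.add hb.2⟩
  zero_mem' := ⟨Literature.Geometry.Lorentzian.boundedVariationOn_const (0 : ℝ) _, integrable_zero _ _ _⟩
  smul_mem' c x hf := ⟨hf.1.const_smul c, (hf.2.smul c : Integrable (c • x) volume)⟩

/-- Membership in the carrier is bounded variation on `ℝ` plus integrability. [folklore] -/
lemma mem_christodoulouDataSpace {ϑ : ℝ → ℝ} :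
    ϑ ∈ christodoulouDataSpace ↔ BoundedVariationOn ϑ univ ∧ Integrable ϑ volume := Iff.rfl

/-- **Christodoulou's normalisation of BV data: right-continuous representatives.** "solutions
of bounded variation have the property that `θ(t, s)` is at each `t`, in particular at `t = 0`,
continuous from the right with respect to `s`" (Christodoulou, Ann. of Math. 149 (1999),
p. 204, proof of Thm. 2.1; the framework of CPAM 46 (1993) §1), so that "the space of initial
data `BV ∩ L¹` on the real line" of Theorem 4.1 consists of right-continuous functions and the
value `θ₀(0) = ϑ(0)` used in Theorems 2.1, 3.1, (4.3), (4.8) is that of this representative.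
The class is a real subspace of `christodoulouDataSpace` (sums and multiples of
right-continuous functions are right-continuous); it is the admissible class `𝓓` relative to
which Theorem 4.1 is stated below (`HasLinearCodimAtLeast 𝓓 E 2`: perturbed data are again
normalised data). [cite: Christodoulou1999instability, proof of Thm. 2.1 (p. 204)] [cite: Christodoulou1993, §1] -/
def rightContinuousData : Submodule ℝ christodoulouDataSpace where
  carrier := {ϑ | ∀ x : ℝ, ContinuousWithinAt (ϑ : ℝ → ℝ) (Ici x) x}
  add_mem' {a b} ha hb x := by
    simpa only [Submodule.coe_add] using (ha x).add (hb x)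
  zero_mem' x := by
    rw [show ((0 : christodoulouDataSpace) : ℝ → ℝ) = fun _ ↦ 0 from rfl]
    exact continuousWithinAt_const
  smul_mem' c a ha x := by
    simpa only [Submodule.coe_smul] using (ha x).const_smul c

/-- Membership in the normalised class is right-continuity at every point. [folklore] -/
lemma mem_rightContinuousData {ϑ : christodoulouDataSpace} :
    ϑ ∈ rightContinuousData ↔ ∀ x : ℝ, ContinuousWithinAt (ϑ : ℝ → ℝ) (Ici x) x := Iff.rfl

/-- **The first direction `f₁ := 𝟙_{[0,1)}`** of the 2-plane through an exceptional datum: a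
normalised (right-continuous) `BV ∩ L¹` datum which vanishes on `(−∞, 0)` and has
`f₁(0) = 1`, so that `ϑ + λ₁ f₁` has the same interior solution (hence the same `γ`, `I`) as
`ϑ` but `(ϑ + λ₁ f₁)(0) = lim I + λ₁`, which is all Theorem 2.1 sees (Christodoulou,
Ann. of Math. 149 (1999), p. 215, (4.5), (4.8); the printed example takes `f₁` nonnegative
integrable, vanishing on `(−∞,0)`, absolutely continuous on `[0,∞)` with `lim_{s→0+} f₁ = 1`;
its profile on `(0, ∞)` plays no role in the proof).
[cite: Christodoulou1999instability, §4 (4.5) and (4.8), p. 215] -/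
def christodoulouDir₁ : christodoulouDataSpace := ⟨(Ico 0 1).indicator 1,
  boundedVariationOn_indicator_Ico_one zero_le_one, integrable_indicator_Ico_one 0 1⟩

/-- Unfolding lemma for `christodoulouDir₁`. [folklore] -/
@[simp] lemma christodoulouDir₁_apply (s : ℝ) :
    (christodoulouDir₁ : ℝ → ℝ) s = (Ico (0 : ℝ) 1).indicator 1 s := rfl

/-- `f₁(0) = 1` (the role of Christodoulou's (4.5), `lim_{s→0+} f₁ = 1`, for the normalised
representative). [cite: Christodoulou1999instability, (4.5)] -/
lemma christodoulouDir₁_zero : (christodoulouDir₁ : ℝ → ℝ) 0 = 1 := by simp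

/-- `f₁` vanishes on `(−∞, 0)` (p. 215). [cite: Christodoulou1999instability, §4 p. 215] -/
lemma christodoulouDir₁_of_neg {s : ℝ} (hs : s < 0) : (christodoulouDir₁ : ℝ → ℝ) s = 0 := by
  simp [indicator_of_notMem, not_le.2 hs]

/-- `f₁ = 𝟙_{[0,1)}` is a normalised datum (right-continuous everywhere). [folklore] -/
lemma christodoulouDir₁_mem : christodoulouDir₁ ∈ rightContinuousData :=
  fun x ↦ continuousWithinAt_Ici_indicator_Ico_one 0 1 x

/-! ### Part 4. The functionals `h` (Thm. 3.1) and `F` ((4.6)) -/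

/-- **Christodoulou's functional `h(s)`** of Theorem 3.1 and (4.4):
`h(s) = √( s⁻¹ ∫₀ˢ (e^{s'} ϑ(s') − ϑ(0))² ds' )`, `s > 0`, measuring the deviation of the datum
just outside `S₀` from its value at `S₀` (Christodoulou, Ann. of Math. 149 (1999), Thm. 3.1,
p. 214, and p. 215; meaningful for normalised data, where `ϑ(0)` is the right-continuous
value). For `s ≤ 0` the value is junk (unused). [cite: Christodoulou1999instability, Thm. 3.1 (p. 214)] -/
def christodoulouH (ϑ : ℝ → ℝ) (s : ℝ) : ℝ :=
  Real.sqrt (s⁻¹ * ∫ s' in 0..s, (Real.exp s' * ϑ s' - ϑ 0) ^ 2)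

/-- **The functional of condition (4.6)** on the second direction `f₂`:
`F(s) = s⁻¹ ∫₀ˢ e^{2s'} f₂(s')² ds'`, so that (4.6) reads
`limsup_{s→0+} g(s)⁻¹ √F(s) = ∞` (Christodoulou, Ann. of Math. 149 (1999), (4.6), p. 215).
[cite: Christodoulou1999instability, (4.6) p. 215] -/
def christodoulouF (f : ℝ → ℝ) (s : ℝ) : ℝ :=
  s⁻¹ * ∫ s' in 0..s, Real.exp (2 * s') * f s' ^ 2

/-- `h(s) ≥ 0`. [folklore] -/
lemma christodoulouH_nonneg (ϑ : ℝ → ℝ) (s : ℝ) : 0 ≤ christodoulouH ϑ s := Real.sqrt_nonneg _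

/-- `h(s)² = s⁻¹ ∫_{(0,s]} (e^{s'} ϑ(s') − ϑ(0))² ds'` for `s ≥ 0`. [folklore] -/
lemma christodoulouH_sq {ϑ : ℝ → ℝ} {s : ℝ} (hs : 0 ≤ s) :
    christodoulouH ϑ s ^ 2 = s⁻¹ * ∫ s' in Ioc 0 s, (Real.exp s' * ϑ s' - ϑ 0) ^ 2 := by
  rw [christodoulouH, intervalIntegral.integral_of_le hs, Real.sq_sqrt]
  exact mul_nonneg (inv_nonneg.2 hs) (setIntegral_nonneg measurableSet_Ioc fun _ _ ↦ sq_nonneg _)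

/-- `F(s) = s⁻¹ ∫_{(0,s]} e^{2s'} f(s')² ds'` for `s ≥ 0`. [folklore] -/
lemma christodoulouF_eq {f : ℝ → ℝ} {s : ℝ} (hs : 0 ≤ s) :
    christodoulouF f s = s⁻¹ * ∫ s' in Ioc 0 s, Real.exp (2 * s') * f s' ^ 2 := by
  rw [christodoulouF, intervalIntegral.integral_of_le hs]

/-- `F(s) ≥ 0` for `s ≥ 0`. [folklore] -/
lemma christodoulouF_nonneg (f : ℝ → ℝ) {s : ℝ} (hs : 0 ≤ s) : 0 ≤ christodoulouF f s := by
  rw [christodoulouF_eq hs]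
  exact mul_nonneg (inv_nonneg.2 hs)
    (setIntegral_nonneg measurableSet_Ioc fun _ _ ↦ mul_nonneg (Real.exp_pos _).le (sq_nonneg _))

/-- A function of bounded variation on `ℝ` is bounded (by `|ϑ(0)| +` total variation).
[folklore] -/
lemma exists_bound_of_mem_christodoulouDataSpace (ϑ : christodoulouDataSpace) :
    ∃ B, ∀ x, |(ϑ : ℝ → ℝ) x| ≤ B := by
  refine ⟨|(ϑ : ℝ → ℝ) 0| + (eVariationOn (ϑ : ℝ → ℝ) univ).toReal, fun x ↦ ?_⟩
  have h1 := ϑ.2.1.sub_le (mem_univ x) (mem_univ 0)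
  have h2 := ϑ.2.1.sub_le (mem_univ 0) (mem_univ x)
  rw [abs_le]
  constructor <;> cases abs_le.1 (le_refl |(ϑ : ℝ → ℝ) 0|) <;> linarith

/-- The square of an a.e.-strongly measurable function bounded on `(0, 1]` is integrable on
`(0, s]`, `s ≤ 1`. [folklore] -/
lemma integrableOn_sq_of_bound {Φ : ℝ → ℝ} (hΦ : AEStronglyMeasurable Φ volume) {K : ℝ}
    (hK : ∀ x ∈ Ioc (0 : ℝ) 1, |Φ x| ≤ K) {s : ℝ} (hs : s ≤ 1) :
    IntegrableOn (fun x ↦ Φ x ^ 2) (Ioc 0 s) := by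
  refine Measure.integrableOn_of_bounded (M := K ^ 2) (by simp) (by fun_prop) ?_
  rw [ae_restrict_iff' measurableSet_Ioc]
  refine ae_of_all _ fun x hx ↦ ?_
  rw [norm_pow, Real.norm_eq_abs]
  exact pow_le_pow_left₀ (abs_nonneg _) (hK x ⟨hx.1, hx.2.trans hs⟩) 2

/-- **The step "by (4.4) and (4.6)" of p. 215, quantitative form.** For `s ∈ (0, 1)`, a datum
`ϑ`, a direction `f` with `f(0) = 0` and the perturbed datum `ϑ̃ = ϑ + c f`:
`h̃(s)² ≥ c² F(s)/2 − h(s)²`, from the pointwise inequality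
`(A + c e^{s'} f)² ≥ c² e^{2s'} f²/2 − A²` integrated over `(0, s]`.
[cite: Christodoulou1999instability, §4 p. 215] -/
lemma christodoulouH_add_sq_ge (ϑ f : christodoulouDataSpace) (hf0 : (f : ℝ → ℝ) 0 = 0) (c : ℝ)
    {s : ℝ} (hs : s ∈ Ioo (0 : ℝ) 1) :
    c ^ 2 * christodoulouF f s / 2 - christodoulouH ϑ s ^ 2 ≤
      christodoulouH ((ϑ + c • f : christodoulouDataSpace) : ℝ → ℝ) s ^ 2 := by
  have hs0 : 0 < s := hs.1
  set θc : ℝ → ℝ := ((ϑ + c • f : christodoulouDataSpace) : ℝ → ℝ) with hθc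
  set A : ℝ → ℝ := fun s' ↦ Real.exp s' * (ϑ : ℝ → ℝ) s' - (ϑ : ℝ → ℝ) 0 with hA
  set Bf : ℝ → ℝ := fun s' ↦ Real.exp s' * (f : ℝ → ℝ) s' with hBf
  rw [christodoulouH_sq hs0.le, christodoulouH_sq hs0.le, christodoulouF_eq hs0.le]
  -- the perturbed integrand
  have hEq : EqOn (fun s' ↦ (Real.exp s' * θc s' - θc 0) ^ 2)
      (fun s' ↦ (A s' + c * Bf s') ^ 2) (Ioc 0 s) := by
    intro s' _
    simp only [hθc, hA, hBf, Submodule.coe_add, Submodule.coe_smul, Pi.add_apply,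
      Pi.smul_apply, smul_eq_mul, hf0]
    ring
  rw [setIntegral_congr_fun measurableSet_Ioc hEq]
  -- bounds and integrability
  obtain ⟨Bθ, hBθ⟩ := exists_bound_of_mem_christodoulouDataSpace ϑ
  obtain ⟨Bφ, hBφ⟩ := exists_bound_of_mem_christodoulouDataSpace f
  have hθm : AEStronglyMeasurable (ϑ : ℝ → ℝ) volume := ϑ.2.2.aestronglyMeasurable
  have hφm : AEStronglyMeasurable (f : ℝ → ℝ) volume := f.2.2.aestronglyMeasurable
  have hexp1 : ∀ x ∈ Ioc (0 : ℝ) 1, Real.exp x ≤ Real.exp 1 := fun x hx ↦ Real.exp_le_exp.2 hx.2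
  have hAb : ∀ x ∈ Ioc (0 : ℝ) 1, |A x| ≤ Real.exp 1 * Bθ + Bθ := by
    intro x hx
    simp only [hA]
    have h1 : |Real.exp x * (ϑ : ℝ → ℝ) x| ≤ Real.exp 1 * Bθ := by
      rw [abs_mul, abs_of_nonneg (Real.exp_pos x).le]
      exact mul_le_mul (hexp1 x hx) (hBθ x) (abs_nonneg _) (Real.exp_pos 1).le
    have := abs_sub (Real.exp x * (ϑ : ℝ → ℝ) x) ((ϑ : ℝ → ℝ) 0)
    linarith [hBθ 0]
  have hBfb : ∀ x ∈ Ioc (0 : ℝ) 1, |Bf x| ≤ Real.exp 1 * Bφ := by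
    intro x hx
    simp only [hBf]
    rw [abs_mul, abs_of_nonneg (Real.exp_pos x).le]
    exact mul_le_mul (hexp1 x hx) (hBφ x) (abs_nonneg _) (Real.exp_pos 1).le
  have hABb : ∀ x ∈ Ioc (0 : ℝ) 1,
      |A x + c * Bf x| ≤ Real.exp 1 * Bθ + Bθ + |c| * (Real.exp 1 * Bφ) := by
    intro x hx
    have h1 := abs_add_le (A x) (c * Bf x)
    have h2 : |c * Bf x| ≤ |c| * (Real.exp 1 * Bφ) := by
      rw [abs_mul]; exact mul_le_mul_of_nonneg_left (hBfb x hx) (abs_nonneg c)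
    linarith [hAb x hx]
  have hAm : AEStronglyMeasurable A volume := by simp only [hA]; fun_prop
  have hBfm : AEStronglyMeasurable Bf volume := by simp only [hBf]; fun_prop
  have hI0 : IntegrableOn (fun s' ↦ A s' ^ 2) (Ioc 0 s) := integrableOn_sq_of_bound hAm hAb hs.2.le
  have hIB : IntegrableOn (fun s' ↦ Bf s' ^ 2) (Ioc 0 s) :=
    integrableOn_sq_of_bound hBfm hBfb hs.2.le
  have hI1 : IntegrableOn (fun s' ↦ (A s' + c * Bf s') ^ 2) (Ioc 0 s) :=
    integrableOn_sq_of_bound (hAm.add (hBfm.const_mul c)) hABb hs.2.le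
  -- pointwise `(A + cB)² ≥ c² B²/2 − A²`
  have hpt : ∀ s' ∈ Ioc (0 : ℝ) s,
      c ^ 2 * Bf s' ^ 2 / 2 - A s' ^ 2 ≤ (A s' + c * Bf s') ^ 2 := by
    intro s' _
    nlinarith [sq_nonneg (2 * A s' + c * Bf s')]
  have hIc : IntegrableOn (fun s' ↦ c ^ 2 * Bf s' ^ 2 / 2) (Ioc 0 s) := by
    have := hIB.const_mul (c ^ 2 / 2)
    refine this.congr (ae_of_all _ fun x ↦ ?_)
    ring
  have hmono := setIntegral_mono_on (hIc.sub hI0) hI1 measurableSet_Ioc hpt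
  simp only [Pi.sub_apply] at hmono
  rw [integral_sub hIc hI0] at hmono
  have hconst : ∫ s' in Ioc 0 s, c ^ 2 * Bf s' ^ 2 / 2 =
      c ^ 2 / 2 * ∫ s' in Ioc 0 s, Real.exp (2 * s') * (f : ℝ → ℝ) s' ^ 2 := by
    rw [← integral_const_mul]
    refine setIntegral_congr_fun measurableSet_Ioc fun x _ ↦ ?_
    simp only [hBf, mul_pow, ← Real.exp_nat_mul]
    ring_nf
  rw [hconst] at hmono
  have hsinv : 0 < s⁻¹ := inv_pos.2 hs0
  calc c ^ 2 * (s⁻¹ * ∫ s' in Ioc 0 s, Real.exp (2 * s') * (f : ℝ → ℝ) s' ^ 2) / 2 -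
        s⁻¹ * ∫ s' in Ioc 0 s, A s' ^ 2
      = s⁻¹ * (c ^ 2 / 2 * (∫ s' in Ioc 0 s, Real.exp (2 * s') * (f : ℝ → ℝ) s' ^ 2) -
          ∫ s' in Ioc 0 s, A s' ^ 2) := by ring
    _ ≤ s⁻¹ * ∫ s' in Ioc 0 s, (A s' + c * Bf s') ^ 2 :=
        mul_le_mul_of_nonneg_left hmono hsinv.le


/-- **The step "by (4.4) and (4.6)" of p. 215.** If `limsup_{s→0+} h(s)/g(s) < ∞` for the
datum `ϑ` (condition (4.4)), `g > 0` on `(0,1)`, and the direction `f` (with `f(0) = 0`)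
satisfies (4.6), `limsup_{s→0+} √F(s)/g(s) = ∞`, then for every `c ≠ 0` the perturbed datum
`ϑ + c f` has `limsup_{s→0+} h̃(s)/g(s) = ∞`, so that Theorem 3.1 applies to it (`limsup = ∞`
of a nonnegative ratio being rendered as "not eventually bounded above along `𝓝[>] 0`",
`Filter.IsBoundedUnder`): otherwise `c² F/2 ≤ h̃² + h² ≤ (C'² + C²) g²` eventually, bounding
`√F/g`. [cite: Christodoulou1999instability, §4 p. 215] -/
lemma not_isBoundedUnder_christodoulouH_add (ϑ f : christodoulouDataSpace)
    (hf0 : (f : ℝ → ℝ) 0 = 0) {g : ℝ → ℝ} (hgpos : ∀ s ∈ Ioo (0 : ℝ) 1, 0 < g s)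
    (hb : IsBoundedUnder (· ≤ ·) (𝓝[>] (0 : ℝ)) (fun s ↦ christodoulouH ϑ s / g s))
    (h46 : ¬ IsBoundedUnder (· ≤ ·) (𝓝[>] (0 : ℝ))
      (fun s ↦ Real.sqrt (christodoulouF f s) / g s))
    {c : ℝ} (hc : c ≠ 0) :
    ¬ IsBoundedUnder (· ≤ ·) (𝓝[>] (0 : ℝ)) (fun s ↦
      christodoulouH ((ϑ + c • f : christodoulouDataSpace) : ℝ → ℝ) s / g s) := by
  intro hb'
  apply h46
  set θc : ℝ → ℝ := ((ϑ + c • f : christodoulouDataSpace) : ℝ → ℝ) with hθc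
  have hIoo : ∀ᶠ s in 𝓝[>] (0 : ℝ), s ∈ Ioo (0 : ℝ) 1 := Ioo_mem_nhdsGT zero_lt_one
  obtain ⟨C, hC⟩ := hb
  obtain ⟨C', hC'⟩ := hb'
  have hCe : ∀ᶠ s in 𝓝[>] (0 : ℝ), christodoulouH ϑ s / g s ≤ C := hC
  have hCe' : ∀ᶠ s in 𝓝[>] (0 : ℝ), christodoulouH θc s / g s ≤ C' := hC'
  set D : ℝ := C' ^ 2 + C ^ 2 with hD
  refine isBoundedUnder_of_eventually_le (a := Real.sqrt (2 * D / c ^ 2)) ?_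
  filter_upwards [hIoo, hCe, hCe'] with s hs hCs hCs'
  have hg : 0 < g s := hgpos s hs
  have h1 : christodoulouH ϑ s ≤ C * g s := by rwa [div_le_iff₀ hg] at hCs
  have h1' : christodoulouH θc s ≤ C' * g s := by rwa [div_le_iff₀ hg] at hCs'
  have h2 : christodoulouH ϑ s ^ 2 ≤ (C * g s) ^ 2 :=
    pow_le_pow_left₀ (christodoulouH_nonneg _ _) h1 2
  have h2' : christodoulouH θc s ^ 2 ≤ (C' * g s) ^ 2 :=
    pow_le_pow_left₀ (christodoulouH_nonneg _ _) h1' 2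
  have h3 := christodoulouH_add_sq_ge ϑ f hf0 c hs
  have hc2 : 0 < c ^ 2 := by positivity
  have hF : christodoulouF f s ≤ 2 * D / c ^ 2 * g s ^ 2 := by
    rw [div_mul_eq_mul_div, le_div_iff₀ hc2]
    nlinarith
  rw [div_le_iff₀ hg]
  calc Real.sqrt (christodoulouF f s) ≤ Real.sqrt (2 * D / c ^ 2 * g s ^ 2) :=
        Real.sqrt_le_sqrt hF
    _ = Real.sqrt (2 * D / c ^ 2) * g s := by
        rw [Real.sqrt_mul' _ (sq_nonneg _), Real.sqrt_sq hg.le]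

/-! ### Part 5. The printed input as a hypothesis structure; Theorem 4.1 (proved) -/

/-- **The printed input of §§1–4 of Christodoulou (1999) entering the proof of Theorem 4.1,
as a hypothesis structure.** To every normalised datum `ϑ` (`rightContinuousData`, in the
coordinate `s` with `s = 0 ↔ S₀`, §1 pp. 186–187) the paper attaches, along the past light cone
`C₀⁻` of the first singular point `O`: the function `γ(t) = ∫₀ᵗ (κ₀(t') − 1) dt'` ((2.1), with
`κ₀ ≥ 1` by (1.27b)), the function `I(t)` ((2.9b)), and, in Theorem 3.1, the function
`g(s) = e^{−γ(t)/4}` of `s = e^{−t−5γ(t)} ∈ (0, 1)`; the **exceptional set** `E` is "the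
subset `E` of the space of initial conditions of bounded variation on `C₀⁺`, which lead to
the formation of a singular boundary `B`, with the function `γ`, defined along `C₀⁻`, the
past light cone of `O`, the past end point of the central component `B₀` of `B`, being
unbounded, while the conclusion of Theorem 2.1 fails" (§4, p. 214); the conclusion of
Theorem 2.1 ("`A` is nonempty, `v₀ = v* = 0`, so that `B₀ = O` and both `A` and `B ∖ B₀`
issue from `O`", p. 192) means that a trapped region issues from `O`, so that `O` is not
naked (§1, p. 184). Finally §4 uses a second direction `f₂`: "Let also `f₂` be a nonnegative
integrable absolutely continuous function on the real line, vanishing on `(−∞, 0]`, such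
that `limsup_{s→0+} { g(s)⁻¹ √( s⁻¹ ∫₀ˢ e^{2s'} f₂²(s') ds' ) } = ∞` (4.6). For example, we may
define `f₂` on `(0,1)` so that `s⁻¹ ∫₀ˢ e^{2s'} f₂² ds' = g(s)`" (p. 215), the same for data
agreeing on `(−∞,0)` ("they define the same functions `γ(t)`, `I(t)` and `g(s)`, and the same
functions `f₁(s)`, `f₂(s)`", p. 216). The fields record exactly what §4 uses: (a) **domain of
dependence** — "Since the restrictions of `ϑ̃_{(λ₁,λ₂)}` and `ϑ` to the interval `(−∞, 0)`
coincide, the corresponding solutions coincide in the interior of `C₀⁻` (domain of dependence)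
and define the same functions `γ(t)` and `I(t)`" (p. 215) — for `γ`, `I`, `g` and `f₂`;
(b) `E ⊆ {γ unbounded}` and `E ⊆` normalised data (definition of `E`, p. 214; p. 204);
(c) `g > 0` on `(0,1)` when `γ` is unbounded (`g = e^{−γ/4}`); (d) `f₂ = dir₂ ϑ` is a
normalised `BV ∩ L¹` datum vanishing on `(−∞, 0]` and satisfying (4.6) (p. 215; the
existence of such an `f₂`, asserted in print through the displayed example, is thereby a
hypothesis here, not a theorem); (e) **Theorem 2.1** (p. 192): "Let `γ` be unbounded.
Suppose that either `I` does not tend to a finite limit as `t → ∞` or, otherwise,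
`θ₀(0) ≠ lim_{t→∞} I(t)`. Then [the conclusion holds]" — equivalently `¬ (I(t) → ϑ(0))` —
hence `ϑ ∉ E`, for normalised `ϑ`; (f) **Theorem 3.1** (pp. 213–214): "Let `γ` be unbounded
and let `I(t) → θ₀(0)` as `t → ∞`. [...] Then if `limsup_{s→0+} h(s)/g(s) = ∞`, then the
conclusion of Theorem 2.1 holds" — hence `ϑ ∉ E`, for normalised `ϑ`; `limsup = ∞` of the
nonnegative ratio is rendered as "not eventually bounded above along `𝓝[>] 0`"
(`Filter.IsBoundedUnder`). For data whose development has no first singular point `O` the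
attached objects are irrelevant (such data are not in `E`, and (e), (f) only conclude
non-membership); an instance may assign them arbitrarily subject to (a)–(d). The structure is
**not instantiated in the tree**: the BV solution theory of CPAM 46 (1993) §1 in which `E`,
`γ`, `I`, `g` are defined is not formalised (the v0 prelude
`Literature.Geometry.Lorentzian.SphericalEinsteinScalar` has classical solutions only; see
`CosmicCensorship.lean`, "Not stated in v0 (3)"). Theorem 4.1 is proved below for every
instance. [cite: Christodoulou1999instability, §1 (1.13) (1.27b), §2 (2.1) (2.9b) Thm. 2.1 and p. 204, §3 Thm. 3.1, §4 pp. 214–216] -/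
structure ChristodoulouInstabilityData where
  /-- The exceptional set `E` (§4, p. 214), a set of normalised data. -/
  E : Set christodoulouDataSpace
  /-- "`γ` is unbounded", `γ(t) = ∫₀ᵗ (κ₀ - 1) dt'` along `C₀⁻` ((2.1), p. 189). -/
  GammaUnbounded : christodoulouDataSpace → Prop
  /-- The function `I(t)` of (2.9b) along `C₀⁻`. -/
  I : christodoulouDataSpace → ℝ → ℝ
  /-- The function `g(s)` on `(0,1)` of Theorem 3.1 (`g(s) = e^{-γ(t)/4}`, `s = e^{-t-5γ(t)}`). -/
  g : christodoulouDataSpace → ℝ → ℝ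
  /-- The second direction `f₂` of p. 215 attached to a datum (depends on `ϑ|_{(-∞,0)}` only). -/
  dir₂ : christodoulouDataSpace → christodoulouDataSpace
  /-- `E` consists of normalised (right-continuous) data (p. 204). -/
  subset_rightContinuousData : E ⊆ rightContinuousData
  /-- Domain of dependence (p. 215): data agreeing on `(-∞,0)` have the same `γ`. -/
  gammaUnbounded_congr : ∀ ⦃ϑ ϑ' : christodoulouDataSpace⦄, EqOn (ϑ : ℝ → ℝ) ϑ' (Iio 0) →
    (GammaUnbounded ϑ ↔ GammaUnbounded ϑ')
  /-- Domain of dependence (p. 215): data agreeing on `(-∞,0)` have the same `I`. -/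
  I_congr : ∀ ⦃ϑ ϑ' : christodoulouDataSpace⦄, EqOn (ϑ : ℝ → ℝ) ϑ' (Iio 0) → I ϑ = I ϑ'
  /-- Domain of dependence (pp. 215–216): data agreeing on `(-∞,0)` have the same `g`. -/
  g_congr : ∀ ⦃ϑ ϑ' : christodoulouDataSpace⦄, EqOn (ϑ : ℝ → ℝ) ϑ' (Iio 0) → g ϑ = g ϑ'
  /-- "the same functions `f₁(s)`, `f₂(s)`" for data agreeing on `(-∞,0)` (p. 216). -/
  dir₂_congr : ∀ ⦃ϑ ϑ' : christodoulouDataSpace⦄, EqOn (ϑ : ℝ → ℝ) ϑ' (Iio 0) →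
    dir₂ ϑ = dir₂ ϑ'
  /-- Definition of `E` (§4, p. 214): for `ϑ ∈ E` the function `γ` is unbounded. -/
  gammaUnbounded_of_mem : ∀ ⦃ϑ : christodoulouDataSpace⦄, ϑ ∈ E → GammaUnbounded ϑ
  /-- `g = e^{-γ/4} > 0` on `(0,1)` (Theorem 3.1, p. 214). -/
  g_pos : ∀ ⦃ϑ : christodoulouDataSpace⦄, GammaUnbounded ϑ → ∀ s ∈ Ioo (0 : ℝ) 1, 0 < g ϑ s
  /-- `f₂` is a normalised `BV ∩ L¹` datum (p. 215: "nonnegative integrable absolutely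
  continuous"). -/
  dir₂_mem : ∀ ϑ : christodoulouDataSpace, dir₂ ϑ ∈ rightContinuousData
  /-- `f₂` vanishes on `(-∞, 0]` (p. 215). -/
  dir₂_apply_of_nonpos : ∀ (ϑ : christodoulouDataSpace) (s : ℝ), s ≤ 0 →
    (dir₂ ϑ : ℝ → ℝ) s = 0
  /-- Condition **(4.6)** (p. 215): `limsup_{s→0+} g(s)⁻¹ √(s⁻¹∫₀ˢ e^{2s'} f₂² ds') = ∞`
  when `γ` is unbounded. -/
  dir₂_not_isBoundedUnder : ∀ ⦃ϑ : christodoulouDataSpace⦄, GammaUnbounded ϑ →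
    ¬ IsBoundedUnder (· ≤ ·) (𝓝[>] (0 : ℝ))
      (fun s ↦ Real.sqrt (christodoulouF (dir₂ ϑ) s) / g ϑ s)
  /-- **Theorem 2.1** (p. 192) with the definition of `E`, for normalised data: if `γ` is
  unbounded and `I(t)` does not tend to `ϑ(0)`, the conclusion of Theorem 2.1 holds, so `ϑ ∉ E`. -/
  notMem_of_not_tendsto : ∀ ⦃ϑ : christodoulouDataSpace⦄, ϑ ∈ rightContinuousData →
    GammaUnbounded ϑ → ¬ Tendsto (I ϑ) atTop (𝓝 ((ϑ : ℝ → ℝ) 0)) → ϑ ∉ E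
  /-- **Theorem 3.1** (pp. 213–214) with the definition of `E`, for normalised data: if `γ` is
  unbounded, `I(t) → ϑ(0)` and `limsup_{s → 0+} h(s)/g(s) = ∞`, the conclusion of Theorem 2.1
  holds, so `ϑ ∉ E`. -/
  notMem_of_not_isBoundedUnder : ∀ ⦃ϑ : christodoulouDataSpace⦄, ϑ ∈ rightContinuousData →
    GammaUnbounded ϑ → Tendsto (I ϑ) atTop (𝓝 ((ϑ : ℝ → ℝ) 0)) →
    ¬ IsBoundedUnder (· ≤ ·) (𝓝[>] (0 : ℝ)) (fun s ↦ christodoulouH ϑ s / g ϑ s) → ϑ ∉ E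

namespace ChristodoulouInstabilityData

variable (T : ChristodoulouInstabilityData)

/-- **(4.3)**: for `ϑ ∈ E`, `I(t) → ϑ(0)` as `t → ∞` ("according to Theorems 2.1 and 3.1",
p. 214 — here: the contrapositive of the Theorem 2.1 field).
[cite: Christodoulou1999instability, (4.3) p. 214] -/
theorem tendsto_I_of_mem {ϑ : christodoulouDataSpace} (hϑ : ϑ ∈ T.E) :
    Tendsto (T.I ϑ) atTop (𝓝 ((ϑ : ℝ → ℝ) 0)) := by
  by_contra h
  exact T.notMem_of_not_tendsto (T.subset_rightContinuousData hϑ) (T.gammaUnbounded_of_mem hϑ)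
    h hϑ

/-- **(4.4)**: for `ϑ ∈ E`, `limsup_{s→0+} h(s)/g(s) < ∞` (eventual boundedness of `h/g`
along `𝓝[>] 0`; the contrapositive of the Theorem 3.1 field given (4.3)).
[cite: Christodoulou1999instability, (4.4) p. 215] -/
theorem isBoundedUnder_of_mem {ϑ : christodoulouDataSpace} (hϑ : ϑ ∈ T.E) :
    IsBoundedUnder (· ≤ ·) (𝓝[>] (0 : ℝ)) (fun s ↦ christodoulouH ϑ s / T.g ϑ s) := by
  by_contra h
  exact T.notMem_of_not_isBoundedUnder (T.subset_rightContinuousData hϑ)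
    (T.gammaUnbounded_of_mem hϑ) (T.tendsto_I_of_mem hϑ) h hϑ

/-- `f₂(0) = 0` (`f₂` vanishes on `(−∞, 0]`, p. 215). [cite: Christodoulou1999instability, §4 p. 215] -/
lemma dir₂_zero (ϑ : christodoulouDataSpace) : (T.dir₂ ϑ : ℝ → ℝ) 0 = 0 :=
  T.dir₂_apply_of_nonpos ϑ 0 le_rfl

/-- `f₂ ≠ 0` (from (4.6): the zero direction has `F ≡ 0`). [cite: Christodoulou1999instability, (4.6) p. 215] -/
lemma dir₂_ne_zero {ϑ : christodoulouDataSpace} (hΓ : T.GammaUnbounded ϑ) : T.dir₂ ϑ ≠ 0 := by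
  intro h0
  apply T.dir₂_not_isBoundedUnder hΓ
  refine isBoundedUnder_of_eventually_le (a := 0) (Eventually.of_forall fun s ↦ ?_)
  simp [h0, christodoulouF]

/-- The two directions are linearly independent (evaluate at `0`: `f₁(0) = 1`, `f₂(0) = 0`, and
`f₂ ≠ 0`), so they span the "2-dimensional linear subspace `Π_ϑ`" of Theorem 4.1.
[cite: Christodoulou1999instability, Thm. 4.1 (p. 216)] -/
lemma linearIndependent_dirs {ϑ : christodoulouDataSpace} (hΓ : T.GammaUnbounded ϑ) :
    LinearIndependent ℝ ![christodoulouDir₁, T.dir₂ ϑ] := by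
  rw [LinearIndependent.pair_iff]
  intro a b hab
  have h0 := congr_arg (fun ψ : christodoulouDataSpace ↦ (ψ : ℝ → ℝ) 0) hab
  simp only [Submodule.coe_add, Submodule.coe_smul, Pi.add_apply, Pi.smul_apply, smul_eq_mul,
    christodoulouDir₁_zero, T.dir₂_zero, mul_one, mul_zero, add_zero, Submodule.coe_zero,
    Pi.zero_apply] at h0
  subst h0
  simp only [zero_smul, zero_add] at hab
  exact ⟨rfl, (smul_eq_zero.1 hab).resolve_right (T.dir₂_ne_zero hΓ)⟩

/-- The perturbed datum `ϑ̃_{(λ₁,λ₂)} = ϑ + λ₁ f₁ + λ₂ f₂` ((4.7)) agrees with `ϑ` on `(−∞, 0)`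
("the restrictions of `ϑ̃_{(λ₁,λ₂)}` and `ϑ` to the interval `(−∞, 0)` coincide", p. 215).
[cite: Christodoulou1999instability, (4.7) p. 215] -/
lemma eqOn_add_dirs (ϑ ϑ₀ : christodoulouDataSpace) (c₁ c₂ : ℝ) :
    EqOn (ϑ : ℝ → ℝ)
      ((ϑ + c₁ • christodoulouDir₁ + c₂ • T.dir₂ ϑ₀ : christodoulouDataSpace) : ℝ → ℝ)
      (Iio 0) := by
  intro s hs
  simp only [Submodule.coe_add, Submodule.coe_smul, Pi.add_apply, Pi.smul_apply, smul_eq_mul,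
    christodoulouDir₁_of_neg hs, T.dir₂_apply_of_nonpos ϑ₀ s (le_of_lt hs), mul_zero, add_zero]

/-- **(4.8)**: `ϑ̃_{(λ₁,λ₂)}(0) = ϑ(0) + λ₁`. [cite: Christodoulou1999instability, (4.8) p. 215] -/
lemma add_dirs_apply_zero (ϑ ϑ₀ : christodoulouDataSpace) (c₁ c₂ : ℝ) :
    ((ϑ + c₁ • christodoulouDir₁ + c₂ • T.dir₂ ϑ₀ : christodoulouDataSpace) : ℝ → ℝ) 0 =
      (ϑ : ℝ → ℝ) 0 + c₁ := by
  simp only [Submodule.coe_add, Submodule.coe_smul, Pi.add_apply, Pi.smul_apply, smul_eq_mul,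
    christodoulouDir₁_zero, T.dir₂_zero, mul_one, mul_zero, add_zero]

/-- The perturbed datum of a normalised datum is normalised (the admissible class is a linear
subspace containing `f₁` and `f₂`). [folklore] -/
lemma add_dirs_mem {ϑ : christodoulouDataSpace} (hϑ : ϑ ∈ rightContinuousData)
    (ϑ₀ : christodoulouDataSpace) (c₁ c₂ : ℝ) :
    ϑ + c₁ • christodoulouDir₁ + c₂ • T.dir₂ ϑ₀ ∈ rightContinuousData :=
  rightContinuousData.add_mem (rightContinuousData.add_mem hϑ
    (rightContinuousData.smul_mem c₁ christodoulouDir₁_mem))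
    (rightContinuousData.smul_mem c₂ (T.dir₂_mem ϑ₀))

/-- **The 2-plane through an exceptional datum meets `E` only at the datum** (p. 215): for
`ϑ ∈ E` and `(λ₁, λ₂) ≠ (0, 0)`, `ϑ̃_{(λ₁,λ₂)} ∉ E` — "if `λ₁ ≠ 0`, then Theorem 2.1 applies so
that `ϑ̃_{(λ₁,λ₂)} ∉ E`, while if `λ₁ = 0`, `λ₂ ≠ 0`, then by (4.4) and (4.6),
`limsup_{s→0+} h̃_{(λ₁,λ₂)}(s)/g(s) = ∞`. Hence Theorem 3.1 applies and again
`ϑ̃_{(λ₁,λ₂)} ∉ E`." [cite: Christodoulou1999instability, §4 p. 215] -/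
theorem add_dirs_notMem {ϑ : christodoulouDataSpace} (hϑ : ϑ ∈ T.E) {c₁ c₂ : ℝ}
    (hc : c₁ ≠ 0 ∨ c₂ ≠ 0) :
    ϑ + c₁ • christodoulouDir₁ + c₂ • T.dir₂ ϑ ∉ T.E := by
  set ϑ' : christodoulouDataSpace := ϑ + c₁ • christodoulouDir₁ + c₂ • T.dir₂ ϑ with hϑ'
  have heq : EqOn (ϑ : ℝ → ℝ) ϑ' (Iio 0) := T.eqOn_add_dirs ϑ ϑ c₁ c₂
  have hmem : ϑ' ∈ rightContinuousData := T.add_dirs_mem (T.subset_rightContinuousData hϑ) ϑ c₁ c₂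
  have hΓ0 : T.GammaUnbounded ϑ := T.gammaUnbounded_of_mem hϑ
  have hΓ : T.GammaUnbounded ϑ' := (T.gammaUnbounded_congr heq).1 hΓ0
  have hI : T.I ϑ' = T.I ϑ := (T.I_congr heq).symm
  have hg : T.g ϑ' = T.g ϑ := (T.g_congr heq).symm
  have h0 : (ϑ' : ℝ → ℝ) 0 = (ϑ : ℝ → ℝ) 0 + c₁ := T.add_dirs_apply_zero ϑ ϑ c₁ c₂
  have hlim := T.tendsto_I_of_mem hϑ
  by_cases hc₁ : c₁ = 0
  · -- the `f₂` direction: Theorem 3.1 via (4.4) and (4.6)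
    have hc₂ : c₂ ≠ 0 := hc.resolve_left (not_not.2 hc₁)
    refine T.notMem_of_not_isBoundedUnder hmem hΓ ?_ ?_
    · rw [hI, h0, hc₁, add_zero]
      exact hlim
    · have hϑ'' : ϑ' = ϑ + c₂ • T.dir₂ ϑ := by rw [hϑ', hc₁, zero_smul, add_zero]
      rw [hg, hϑ'']
      exact not_isBoundedUnder_christodoulouH_add ϑ (T.dir₂ ϑ) (T.dir₂_zero ϑ) (T.g_pos hΓ0)
        (T.isBoundedUnder_of_mem hϑ) (T.dir₂_not_isBoundedUnder hΓ0) hc₂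
  · -- the `f₁` direction: Theorem 2.1
    refine T.notMem_of_not_tendsto hmem hΓ fun hlim' ↦ hc₁ ?_
    rw [hI, h0] at hlim'
    have := tendsto_nhds_unique hlim hlim'
    linarith

/-- **Theorem 4.1, first clause** (Christodoulou, Ann. of Math. 149 (1999), p. 216): "for each
`ϑ ∈ E` there is a 2-dimensional linear subspace `Π_ϑ` such that `(Π_ϑ ∖ {ϑ}) ∩ E = ∅`",
in the prelude's language and inside the normalised data space: the exceptional set has linear
codimension at least `2` relative to `rightContinuousData`
(`Literature.Lorentz.HasLinearCodimAtLeast 𝓓 E 2`, directions `f₁ = 𝟙_{[0,1)}` and `f₂ = T.dir₂ ϑ`,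
the affine plane staying inside the normalised class). Proved from the hypothesis structure.
[cite: Christodoulou1999instability, Thm. 4.1 (p. 216)] -/
theorem hasLinearCodimAtLeast_two :
    HasLinearCodimAtLeast (rightContinuousData : Set christodoulouDataSpace) T.E 2 := by
  intro ϑ hϑ
  refine ⟨![christodoulouDir₁, T.dir₂ ϑ], T.linearIndependent_dirs (T.gammaUnbounded_of_mem hϑ),
    fun c ↦ ?_, fun c hc ↦ ?_⟩
  · have hsum : ϑ + ∑ i, c i • ![christodoulouDir₁, T.dir₂ ϑ] i =
        ϑ + c 0 • christodoulouDir₁ + c 1 • T.dir₂ ϑ := by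
      simp [Fin.sum_univ_two, add_assoc]
    rw [hsum]
    exact T.add_dirs_mem (T.subset_rightContinuousData hϑ) ϑ (c 0) (c 1)
  · have hc' : c 0 ≠ 0 ∨ c 1 ≠ 0 := by
      by_contra h
      simp only [not_or, not_not] at h
      exact hc (funext fun i ↦ by fin_cases i <;> simp [h.1, h.2])
    have hsum : ϑ + ∑ i, c i • ![christodoulouDir₁, T.dir₂ ϑ] i =
        ϑ + c 0 • christodoulouDir₁ + c 1 • T.dir₂ ϑ := by
      simp [Fin.sum_univ_two, add_assoc]
    rw [hsum]
    exact T.add_dirs_notMem hϑ hc'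

/-- **Theorem 4.1, second clause** (p. 216): "if `ϑ, ϑ' ∈ E`, then `Π_ϑ ∩ Π_ϑ' = ∅` unless `ϑ`
and `ϑ'` coincide" — the affine 2-planes `ϑ + span{f₁, f₂}` through distinct exceptional data
are disjoint. Printed proof: a common point forces `ϑ = ϑ'` on `(−∞, 0)`, hence the same `I`,
`g`, `f₂`; by (4.3) `ϑ(0) = ϑ'(0) = lim I`, so `λ₁ = λ₁'`; then `ϑ − ϑ' = (λ₂' − λ₂) f₂`, and
`λ₂' ≠ λ₂` would contradict (4.4) for `ϑ` via (4.6). Proved from the hypothesis structure.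
[cite: Christodoulou1999instability, Thm. 4.1 (p. 216)] -/
theorem eq_of_add_dirs_eq {ϑ ϑ' : christodoulouDataSpace} (hϑ : ϑ ∈ T.E) (hϑ' : ϑ' ∈ T.E)
    {c₁ c₂ c₁' c₂' : ℝ}
    (h : ϑ + c₁ • christodoulouDir₁ + c₂ • T.dir₂ ϑ = ϑ' + c₁' • christodoulouDir₁ + c₂' • T.dir₂ ϑ') :
    ϑ = ϑ' := by
  have heq : EqOn (ϑ : ℝ → ℝ) ϑ' (Iio 0) := by
    intro s hs
    have h1 := T.eqOn_add_dirs ϑ ϑ c₁ c₂ hs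
    have h2 := T.eqOn_add_dirs ϑ' ϑ' c₁' c₂' hs
    rw [h1, h2, h]
  have hI : T.I ϑ' = T.I ϑ := (T.I_congr heq).symm
  have hdir : T.dir₂ ϑ' = T.dir₂ ϑ := (T.dir₂_congr heq).symm
  rw [hdir] at h
  have h00 : (ϑ : ℝ → ℝ) 0 = (ϑ' : ℝ → ℝ) 0 := by
    have h1 := T.tendsto_I_of_mem hϑ
    have h2 := T.tendsto_I_of_mem hϑ'
    rw [hI] at h2
    exact tendsto_nhds_unique h1 h2
  have hc₁ : c₁ = c₁' := by
    have := congr_arg (fun ψ : christodoulouDataSpace ↦ (ψ : ℝ → ℝ) 0) h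
    simp only [T.add_dirs_apply_zero] at this
    linarith
  have hϑeq : ϑ = ϑ' + (0 : ℝ) • christodoulouDir₁ + (c₂' - c₂) • T.dir₂ ϑ := by
    rw [hc₁] at h
    calc ϑ = (ϑ + c₁' • christodoulouDir₁ + c₂ • T.dir₂ ϑ) - c₁' • christodoulouDir₁ -
          c₂ • T.dir₂ ϑ := by module
      _ = (ϑ' + c₁' • christodoulouDir₁ + c₂' • T.dir₂ ϑ) - c₁' • christodoulouDir₁ -
          c₂ • T.dir₂ ϑ := by rw [h]
      _ = ϑ' + (0 : ℝ) • christodoulouDir₁ + (c₂' - c₂) • T.dir₂ ϑ := by module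
  by_contra hne
  have hc₂ : c₂' - c₂ ≠ 0 := by
    intro h0
    apply hne
    rw [hϑeq, h0, zero_smul, zero_smul, add_zero, add_zero]
  have hmem : ϑ' + (0 : ℝ) • christodoulouDir₁ + (c₂' - c₂) • T.dir₂ ϑ' ∈ T.E := by
    rwa [hdir, ← hϑeq]
  exact T.add_dirs_notMem hϑ' (Or.inr hc₂) hmem

/-- **Consequence (the barrier's bite, relative form): no nonempty relatively open set of
normalised data lies in the exceptional set**, in every topology on the data space making
translations and scalar lines continuous (subtype topology on `rightContinuousData`;
`Literature.Geometry.Lorentzian.HasOpenSubset` fails). Thus no instance of the printed theory supports an "open set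
of naked-singularity data" (the model shape of the negation summit gr.S03
`Literature.Geometry.Lorentzian.NegWeakCosmicCensorship`), and "we may therefore say that `E` has positive codimension
in the space of initial data" (p. 216). [cite: Christodoulou1999instability, Thm. 4.1 (p. 216) and §1 p. 184] -/
theorem not_hasOpenSubset (t : TopologicalSpace christodoulouDataSpace)
    (h₁ : @ContinuousAdd christodoulouDataSpace t _) (h₂ : @ContinuousSMul ℝ christodoulouDataSpace _ _ t) :
    ¬ @HasOpenSubset (rightContinuousData : Set christodoulouDataSpace)
      (@instTopologicalSpaceSubtype christodoulouDataSpace _ t)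
      {d | (d : christodoulouDataSpace) ∈ T.E} := by
  letI := t
  exact not_hasOpenSubset_of_hasLinearCodimAtLeast T.hasLinearCodimAtLeast_two two_ne_zero

/-- A fortiori (absolute form): `E` has empty interior in the whole carrier `BV ∩ L¹`, in every
vector topology. [cite: Christodoulou1999instability, Thm. 4.1 (p. 216)] -/
theorem interior_exceptionalSet_eq_empty (t : TopologicalSpace christodoulouDataSpace)
    (h₁ : @ContinuousAdd christodoulouDataSpace t _) (h₂ : @ContinuousSMul ℝ christodoulouDataSpace _ _ t) :
    @interior christodoulouDataSpace t T.E = ∅ := by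
  letI := t
  exact interior_eq_empty_of_hasLinearCodimAtLeast_univ
    (HasLinearCodimAtLeast.of_subset_univ T.hasLinearCodimAtLeast_two) two_ne_zero

end ChristodoulouInstabilityData

/-- **Barrier: naked singularities of the spherically symmetric self-gravitating scalar field
are non-generic — Christodoulou's instability theorem** (Ann. of Math. 149 (1999), Thm. 4.1,
p. 216), proved here from the printed Theorems 2.1 and 3.1 (and the printed second direction
`f₂`) packaged in `ChristodoulouInstabilityData`: inside the normalised data space
(right-continuous `BV ∩ L¹` data, `rightContinuousData`) the exceptional set `E` of data
leading to naked singularities has linear codimension at least `2` (every `ϑ ∈ E` lies on an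
affine 2-plane `ϑ + span{f₁, f₂}` of normalised data meeting `E` only at `ϑ`), and the planes
through distinct points of `E` are disjoint. Companion facts recorded in this docstring and
the module docstring (not formalisable over the v0 prelude, see `CosmicCensorship.lean`):
`E ≠ ∅` — naked singularities DO form from regular (absolutely continuous, indeed
`C^{1,k²/(1−k²)}`) asymptotically flat data for `0 < k² < 1/3` (Christodoulou 1994; RSR 2023,
§1.1 Thms. 1.1–1.2), and naked singularities exist for the Einstein vacuum equations (RSR
2023, Thm. 1; Shlapentokh-Rothman 2022; Shlapentokh-Rothman 2025, Thm. 9).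

The technique classes stopped are two: (α) *counterexample refutations* of cosmic censorship /
of clause (i) of the final state picture — arguments that exhibit naked-singularity solutions
and conclude against the GENERIC statement, in particular any argument producing an open (or
not-positive-codimension) set of admissible data with incomplete `𝓘⁺` (the shapes of gr.S03
`Literature.Geometry.Lorentzian.NegWeakCosmicCensorship` and `NegWeakCosmicCensorshipCodim`); formally, the class of
sets `𝓔` with `HasOpenSubset` relative to the admissible class (or `interior 𝓔 ≠ ∅`), excluded
by `not_hasOpenSubset_of_hasLinearCodimAtLeast` / `interior_eq_empty_of_hasLinearCodimAtLeast_univ`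
once `HasLinearCodimAtLeast 𝓓 𝓔 m`, `m ≥ 1`, is established; (β) *genericity-blind positive
arguments* — proofs of completeness of `𝓘⁺` whose every step applies to ALL data of a
well-posed class containing Christodoulou's absolutely continuous data (Ann. of Math. 140
(1994)) or, in vacuum, the `C^N ∩ C^{1,cε²}` class of Rodnianski–Shlapentokh-Rothman (Thm. 1,
item 3); formally the universal (non-generic) form `∀ d ∈ 𝓓, P d` of a censorship statement,
as opposed to `IsChristodoulouGeneric 𝓓 P 1` / `HasLinearCodimAtLeast`.
[cite: Christodoulou1994] [cite: RodnianskiShlapentokhRothman2023, Thm. 1 item 3]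

BARRIER (D-0021; every clause is a quotation or close paraphrase of the cited locus):
* technique_class: naked-singularity-counterexample, explicit-counterexample, open-set-of-counterexamples, stable-naked-singularity, fine-tuned-data, self-similar-collapse, genericity-blind, all-data-censorship, non-generic-formulation, codimension-blind, universal-quantifier-over-data
* blocks: (β): the strengthening of weak cosmic censorship / final-state clause (i) obtained by deleting "generic" — "(The original version of) weak cosmic censorship can then be understood as the statement that naked singularities do not arise from the maximal globally hyperbolic developments of complete asymptotically flat initial data" [cite: RodnianskiShlapentokhRothman2023, §1 (after Def. 1.1)] — is false in the spherically symmetric Einstein–scalar-field model ("Thus, the original formulation of weak cosmic censorship conjectures fails for this system!" [cite: RodnianskiShlapentokhRothman2023, §1.1]; "This showed, for the first time, that one needs the word 'generic' in Conjecture 5" [cite: Shlapentokhrothman2025, §2.3 p. 388]) and for the Einstein vacuum equations in the regularity class of RSR ("There exists naked singularity solutions for the Einstein vacuum equations" [cite: Shlapentokhrothman2025, Thm. 9]; [cite: RodnianskiShlapentokhRothman2023, Thm. 1]; [cite: ShlapentokhRothman2022]); hence no genericity-blind argument can establish `Literature.Geometry.Lorentzian.WeakCosmicCensorship`'s conclusion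 for all admissible data of such a class. (α): in the model, `E` has linear codimension `≥ 2` in the (normalised) space `BV ∩ L¹` [cite: Christodoulou1999instability, Thm. 4.1], so (this file, proved from the structure) `E` contains no nonempty relatively open set of normalised data and `interior E = ∅`, in every vector topology, and no open set of naked-singularity data exists; "Despite the existence of these naked singularities, [...] Christodoulou showed that generically naked singularities do not occur for the spherically symmetric Einstein-scalar-field system, and thus weak cosmic censorship holds if we relax the statement to the requirement that naked singularities do not occur for generic initial data. (It is in fact this relaxed version of weak cosmic censorship which is the currently accepted formulation.)" [cite: RodnianskiShlapentokhRothman2023, §1.1].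
* because: existence — for `0 < k² < 1/3` the `k`-self-similar solutions have, along the past light cone `𝒩` of the singular point, `2m/r|_𝒩 = k²/(1+k²) ≠ 0`, so "the hypersurface `𝒩` is future null geodesically incomplete, yet the solution cannot be extended to `𝒪` and remain a solution of bounded variation", and their asymptotically flat truncations have incomplete future null infinity [cite: RodnianskiShlapentokhRothman2023, §1.1 Thm. 1.1 items 3–5 and Thm. 1.2]; instability — "a key role is played by a blue-shift instability along the past light cone of the singularity [...] using only the information on `m/r` as a starting point, Christodoulou is able to show that a blue-shift instability may be triggered by a generic (in the sense of Theorem 7) perturbation, and eventually leads to the conditions of Theorem 6 [trapped surface formation, CPAM 44] being satisfied" [cite: Shlapentokhrothman2025, §2.4 p. 390]; in the paper's terms: the perturbation `λ₁ f₁` moves `ϑ̃(0)` off `lim I(t)` so that Theorem 2.1 (via Theorem* of [cite: Christodoulou1991]) yields a trapped region issuing from `O`, and `λ₂ f₂` makes `limsup h̃/g = ∞` so that Theorem 3.1 does [cite: Christodoulou1999instability, Thm. 2.1, Theorem* (pp. 192–193), Thm. 3.1, §4 p. 215].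
* evasions_known: (i) the generic formulation — positive-codimension exceptional sets [cite: Christodoulou1999, p. A24] — as in `Literature.Geometry.Lorentzian.WeakCosmicCensorship` (`IsChristodoulouGeneric … 1`), which neither (α) nor (β) addresses; (ii) robustness of the instability mechanism beyond Christodoulou's setting: a robust (double-null, a-priori-estimate) proof [cite: LiuLi2018], gravitational (non-spherical) perturbations [cite: LiLiu2022], anisotropic perturbations with an anisotropic apparent horizon and "infinitely many more unstable directions" [cite: An2025] [cite: Shlapentokhrothman2025, §2.4 p. 390], interior instability [cite: Li2025]; (iii) none published for vacuum: the vacuum naked singularities come with an expectation only — "one expects a generic asymptotically flat perturbation which is smooth for `v̂ > 0` and `C¹` at `v̂ = 0` to create an instability and result in trapped surface formation" [cite: RodnianskiShlapentokhRothman2023, Rem. 1.5]; (iv) HIGH REGULARITY (audit 2026-08-15): the blue-shift instability is absent for perturbations at or above the threshold regularity `C^{1,k²/(1−k²)}` of the background scalar field — "Above a threshold regularity set by the `k`-self-similar scalar field, solutions are shown to always obey self-similar bounds, indicating that the blue-shift instability competes with the stabilizing influence of high regularity" [cite: Singh2024, abstract; Thm. 1; Prop. 1.1], with the informal nonlinear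 exterior statement that small exterior perturbations at or above threshold yield solutions existing in every self-similar neighbourhood of the cone, "free of trapped surfaces", and asymptotically stable above threshold [cite: Singh2024, Prop. 1.2 and §1.4]; "the blue-shift heuristic, stated quantitatively, does not hold … with data in any topology that is of the form `C^{1,β}([−1, 0])`, `β > 0`" [cite: Singh2024, §1.4]; NONLINEARLY and globally: for a `k`-self-similar (or admissible approximately self-similar) naked singularity with outgoing datum `∂ᵥ(rφ)(−1, ·)`, every exterior perturbation `ε{χ₁(v)v + (1 − χ₁(v))}g₀(v)` — vanishing LINEARLY at the cone sphere, `g₀ ∈ C¹` with `|g₀| ≲ V⁻²`, `|∂_V g₀| ≲ V⁻³`, and `ε` small "depending on the background solution and the norm `E_{2,α}`" only — again yields a BV solution that is asymptotically flat and "contains an incomplete `𝓘⁺`" [cite: Singh2022, Thm. 5 with data (3.33), §3.2–3.3], i.e. relative to the affine class of Lipschitz-at-`S₀` exterior perturbations the exceptional set contains a norm-ball around the datum (the physical counterpart of `lipschitzConeData ⊆ E` in `nakedSingularityInstabilityNarrow` (C)); "all exterior small nonlinear perturbations in a specific form, which is in `C^{α/(1−α)}`, lead to stability, for any `α ≥ k²`,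 and `k²/(1−k²)` serves as a threshold regularity" [cite: Li2025, §1.2], while instability to black-hole formation holds under `C^{p/(1−p)}` interior or exterior perturbations for every `p ∈ (0, k²)`, i.e. in all regularities strictly below threshold [cite: Li2025, Thms. 1.1–1.2]; formally, both directions of Thm. 4.1 are rough at `S₀` and positive codimension does not descend to the Lipschitz-at-`S₀` class (`nakedSingularityInstabilityNarrow`, Part 6).
* scope_caveats: (a) the instability theorem is printed for the spherically symmetric Einstein–SCALAR-field model in the BV class only; "due to the rigidities imposed by Birkhoff's theorem, we cannot hope to set the scalar field to be 0, and thus Christodoulou's constructions do not yield naked singularity solutions to the Einstein vacuum equations" [cite: RodnianskiShlapentokhRothman2023, §1.1]; (b) regularity: the instability is a low-regularity (blue-shift) phenomenon — for perturbations MORE regular than the background "Singh showed that the blueshift instability is not present [...] these results are consistent with the `k`-self similar singularities being nonlinearly stable to sufficiently regular perturbations! We conclude that the validity of the weak cosmic censorship conjecture may depend sensitively on the precise functional framework" [cite: Shlapentokhrothman2025, §2.5 pp. 390–391] [cite: Singh2024]; and "it is an open problem to rigorously construct smooth (or even `C²`!) initial data for the spherically symmetric Einstein-scalar field system which leads to a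 naked singularity" [cite: Shlapentokhrothman2025, §2.3 p. 389] — so for the smooth data classes of the tree (`InitialDataSet`, `SphSym.BVDevelopment` with classical solutions) neither existence nor instability is available in print; (c) Theorem 4.1 is proved here only relative to `ChristodoulouInstabilityData` (Theorems 2.1, 3.1, the domain of dependence and the printed second direction `f₂` with (4.6) are fields), which is not instantiated in the tree (BV theory of [cite: Christodoulou1993] not formalised), and `E ≠ ∅` [cite: Christodoulou1994] has no formal counterpart; (d) data are right-continuous representatives [cite: Christodoulou1999instability, p. 204] written in the datum-normalised coordinate `s` (`s = 0 ↔ S₀`), as in the printed theorem [cite: Christodoulou1999instability, §1 pp. 186–187, §4 p. 214]; (e) "positive codimension" is the linear notion of Thm. 4.1 (`HasLinearCodimAtLeast`), not a measure- or Baire-category statement; in the absolutely continuous class only the `f₂` direction is admissible (`f₁` jumps at `S₀`), i.e. codimension `≥ 1` there [cite: Christodoulou1999instability, §4 p. 215]; (f) the first direction of this file's proof is the normalised datum `f₁ = 𝟙_{[0,1)}` rather than the printed absolutely continuous profile on `[0,∞)` (only `f₁|_{(−∞,0)} = 0` and `f₁(0) = 1` enter Theorem 2.1), and the second direction `f₂`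 is taken from the structure exactly as printed (its existence with (4.6) is asserted in print via the example `s⁻¹∫₀ˢ e^{2s'} f₂² = g(s)`, not proved) [cite: Christodoulou1999instability, §4 p. 215]; (g) the vacuum examples have `C^N`, `N < ∞`, regularity away from the cone and `C^{1,cε²}` across it [cite: RodnianskiShlapentokhRothman2023, Thm. 1 item 3], "Minor modifications of the proof would allow one to replace `C^N` with `C^∞`" [cite: RodnianskiShlapentokhRothman2023, Rem. 1.7], but no smooth-across-the-cone vacuum example is printed; (h) (audit 2026-08-15, `nakedSingularityInstabilityNarrow`) clause (α) is a statement in the carrier/topology of `BV` (resp. AC) data ONLY: `HasLinearCodimAtLeast 𝓓 E m` is not monotone under shrinking the admissible class `𝓓`, the direction `f₁` is discontinuous at `S₀` (`not_continuousAt_christodoulouDir₁`) and every `f₂` obeying (4.6) has modulus `≠ O(g)` at `S₀` (`ChristodoulouInstabilityData.not_dominated_dir₂`; with the printed `g ≥ s^{1/20}` it is not Hölder-`1/20` there, `.not_holder_dir₂`; on a `k`-self-similar background exactly the sub-threshold Hölder scale, cf. "one can also excite a similar instability with a perturbation which … arranging for the perturbed `p` to be Hölder continuous with a small `k`-dependent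 exponent `γ > 0`" [cite: Shlapentokhrothman2025, §2.4 p. 389]), so relative to any admissible class of data Hölder-continuous at `S₀` above the background threshold — Lipschitz, `C¹`, `C^∞` (the class `IsAdmissibleWCCData` of the tree's `WeakCosmicCensorship`/`NegWeakCosmicCensorship`), weighted Sobolev `H^s` for large `s` — Theorem 4.1 yields codimension `0` and NO printed theorem excludes a relatively open set of naked-singularity data there — on the contrary, relative to the affine class of Lipschitz-at-`S₀` exterior perturbations of a `k`-self-similar datum the exceptional set contains a norm-ball [cite: Singh2022, Thm. 5 with data (3.33)] (evasion (iv)): "In the smooth class, both the question of the formation of naked singularities and the question of their genericity remain open" [cite: CicortasKehle2026, §1.5], "these results are consistent with the `k`-self similar singularities being nonlinearly stable to sufficiently regular perturbations!" [cite: Shlapentokhrothman2025, §2.5 pp. 390–391], "The most natural formulation of the conjecture is to require only that finite regularity naked singularities be unstable to perturbations of commensurate regularity" [cite: Singh2024, §1.4]; the hypothesis structure is moreover formally consistent with a whole nonzero linear class of Lipschitz-at-`S₀` normalised data lying inside `E`, relatively open in every topology (`nakedSingularityInstabilityNarrow` (C)); (i) (audit 2026-08-15) clause (β) bites only admissible classes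 CONTAINING the printed examples (AC/BV and `C^{1,k²/(1−k²)}` for the scalar field; `C^N ∩ C^{1,cε²}` across the cone in vacuum): for `C²` or `C^∞` data — in particular for the tree's `WeakCosmicCensorship`, stated over `C^∞` vacuum data — deleting "generic" yields a statement refuted by no printed theorem, the existence of such naked singularities being open ("it is an open problem to rigorously construct smooth (or even `C²`!) initial data … which leads to a naked singularity" [cite: Shlapentokhrothman2025, §2.3 p. 389]; vacuum: "Can one construct naked singularities arising from smooth, or even `C²` initial data?" [cite: Shlapentokhrothman2025, §4.5 p. 405]); the firm expectation that it is false rests on numerical critical collapse and partial smooth constructions — a computer-assisted smooth discretely self-similar solution near the past cone [cite: ReitererTrubowitz2019] and smooth discretely self-similar exterior-naked-singularity regions whose interior fill-in from smooth data is open [cite: CicortasKehle2026, Thm. 1 and §1.2].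
* status: established in print — [cite: Christodoulou1999instability, Thm. 4.1] [cite: Christodoulou1994] [cite: RodnianskiShlapentokhRothman2023, Thm. 1] (the interior completion of the vacuum example is an arXiv preprint [cite: ShlapentokhRothman2022], reported as a theorem in [cite: Shlapentokhrothman2025, Thm. 9]); formal rendering CONDITIONAL on `ChristodoulouInstabilityData`, uninstantiated (scope caveat (c)): the tree asserts neither the fields for the physical exceptional set (Theorems 2.1, 3.1, domain of dependence, the printed `f₂`) nor `E ≠ ∅`. NARROWED by audit (D-0021, 2026-08-15): the blocks (α), (β) are established in print only in low-regularity classes (BV/AC/sub-threshold Hölder at `S₀`, resp. classes containing the `C^{1,γ}`-across-a-cone examples); at or above the background's threshold regularity — in particular in the smooth classes of the tree — neither is a theorem, see scope caveats (h)–(i), evasion (iv) and `nakedSingularityInstabilityNarrow` (Part 6). -/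
theorem nakedSingularityInstability (T : ChristodoulouInstabilityData) :
    HasLinearCodimAtLeast (rightContinuousData : Set christodoulouDataSpace) T.E 2 ∧
      ∀ ⦃ϑ ϑ' : christodoulouDataSpace⦄, ϑ ∈ T.E → ϑ' ∈ T.E → ∀ c₁ c₂ c₁' c₂' : ℝ,
        ϑ + c₁ • christodoulouDir₁ + c₂ • T.dir₂ ϑ =
          ϑ' + c₁' • christodoulouDir₁ + c₂' • T.dir₂ ϑ' → ϑ = ϑ' :=
  ⟨T.hasLinearCodimAtLeast_two, fun _ _ hϑ hϑ' _ _ _ _ h ↦ T.eq_of_add_dirs_eq hϑ hϑ' h⟩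

/-! ### Part 6. Scope of the barrier (audit, D-0021): the two instability directions live at low
regularity at `S₀`, and positive codimension does not descend to smoother admissible classes -/

/-- **Domination bound.** If `|φ| ≤ L·G` on `(0, s]` with `0 < s ≤ 1`, then
`s⁻¹ ∫_{(0,s]} (e^{s'} φ(s'))² ds' ≤ (e·L·G)²`. [folklore] -/
lemma inv_mul_setIntegral_sq_exp_mul_le {φ : ℝ → ℝ} {L G s : ℝ} (hs : s ∈ Ioc (0 : ℝ) 1)
    (hdom : ∀ s' ∈ Ioc 0 s, |φ s'| ≤ L * G) :
    s⁻¹ * ∫ s' in Ioc 0 s, (Real.exp s' * φ s') ^ 2 ≤ (Real.exp 1 * L * G) ^ 2 := by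
  have hs0 : 0 < s := hs.1
  have hbound : ∀ s' ∈ Ioc (0 : ℝ) s, ‖(Real.exp s' * φ s') ^ 2‖ ≤ (Real.exp 1 * L * G) ^ 2 := by
    intro s' hs'
    rw [norm_pow, Real.norm_eq_abs, abs_mul, abs_of_nonneg (Real.exp_pos s').le]
    have h1 : Real.exp s' ≤ Real.exp 1 := Real.exp_le_exp.2 (hs'.2.trans hs.2)
    have h2 : Real.exp s' * |φ s'| ≤ Real.exp 1 * (L * G) :=
      mul_le_mul h1 (hdom s' hs') (abs_nonneg _) (Real.exp_pos 1).le
    have h3 : 0 ≤ Real.exp s' * |φ s'| := mul_nonneg (Real.exp_pos _).le (abs_nonneg _)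
    calc (Real.exp s' * |φ s'|) ^ 2 ≤ (Real.exp 1 * (L * G)) ^ 2 := pow_le_pow_left₀ h3 h2 2
      _ = (Real.exp 1 * L * G) ^ 2 := by ring
  have hint := norm_setIntegral_le_of_norm_le_const (μ := volume) (s := Ioc (0 : ℝ) s)
    measure_Ioc_lt_top hbound
  rw [Real.volume_real_Ioc_of_le hs0.le, sub_zero, Real.norm_eq_abs] at hint
  have hle : ∫ s' in Ioc 0 s, (Real.exp s' * φ s') ^ 2 ≤ (Real.exp 1 * L * G) ^ 2 * s :=
    (le_abs_self _).trans hint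
  calc s⁻¹ * ∫ s' in Ioc 0 s, (Real.exp s' * φ s') ^ 2
      ≤ s⁻¹ * ((Real.exp 1 * L * G) ^ 2 * s) := mul_le_mul_of_nonneg_left hle (inv_nonneg.2 hs0.le)
    _ = (Real.exp 1 * L * G) ^ 2 := by field_simp

/-- **Condition (4.6) fails for every direction dominated by `g` at `S₀`.** If
`|f(s')| ≤ L·g(s)` for `0 < s' ≤ s < s₀` and `g > 0` on `(0, s₀)`, then `√F(s)/g(s)` is
eventually bounded along `𝓝[>] 0` (`F` = `christodoulouF`, the functional of (4.6)), i.e.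
(4.6) of Christodoulou, Ann. of Math. 149 (1999), p. 215, FAILS: `F(s) ≤ e² L² g(s)²`. Hence a
second instability direction `f₂` of Theorem 4.1 never has modulus `O(g)` at `S₀`
(`sup_{(0,s]} |f₂| ≠ O(g(s))`). With the printed `g(s) = e^{−γ(t)/4}`, `s = e^{−t−5γ(t)}`,
`t ≥ 0` (Thm. 3.1, p. 214) one has `g(s) ≥ s^{1/20}` for every datum, so no direction that is
Hölder continuous of exponent `> 1/20` at `S₀` (a fortiori no Lipschitz, `C¹` or smooth `f₂`
vanishing on `(−∞, 0]`) satisfies (4.6); cf. "The argument crucially relies on rough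
perturbations that trigger a blue-shift instability" (Cicortas–Kehle, arXiv:2412.09540, §1.5)
and Singh, arXiv:2402.00062, Prop. 1.1 (threshold `α = 1/(1−k²)`).
[cite: Christodoulou1999instability, (4.6) p. 215 and Thm. 3.1 p. 214] -/
theorem isBoundedUnder_sqrt_christodoulouF_of_dominated {f g : ℝ → ℝ} {L s₀ : ℝ} (hs₀ : 0 < s₀)
    (hg : ∀ s ∈ Ioo 0 s₀, 0 < g s) (hdom : ∀ s ∈ Ioo 0 s₀, ∀ s' ∈ Ioc 0 s, |f s'| ≤ L * g s) :
    IsBoundedUnder (· ≤ ·) (𝓝[>] (0 : ℝ)) (fun s ↦ Real.sqrt (christodoulouF f s) / g s) := by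
  refine isBoundedUnder_of_eventually_le (a := Real.exp 1 * max L 0) ?_
  filter_upwards [Ioo_mem_nhdsGT (lt_min hs₀ zero_lt_one)] with s hs
  have hs1 : s ∈ Ioc (0 : ℝ) 1 := ⟨hs.1, (hs.2.trans_le (min_le_right _ _)).le⟩
  have hss₀ : s ∈ Ioo 0 s₀ := ⟨hs.1, hs.2.trans_le (min_le_left _ _)⟩
  have hgs : 0 < g s := hg s hss₀
  have hdom' : ∀ s' ∈ Ioc 0 s, |f s'| ≤ max L 0 * g s := fun s' hs' ↦
    (hdom s hss₀ s' hs').trans (mul_le_mul_of_nonneg_right (le_max_left _ _) hgs.le)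
  have hF : christodoulouF f s ≤ (Real.exp 1 * max L 0 * g s) ^ 2 := by
    rw [christodoulouF_eq hs.1.le]
    have heq : EqOn (fun s' ↦ Real.exp (2 * s') * f s' ^ 2)
        (fun s' ↦ (Real.exp s' * f s') ^ 2) (Ioc 0 s) := by
      intro s' _
      simp only [mul_pow, sq (Real.exp s'), ← Real.exp_add, two_mul]
    rw [setIntegral_congr_fun measurableSet_Ioc heq]
    exact inv_mul_setIntegral_sq_exp_mul_le hs1 hdom'
  rw [div_le_iff₀ hgs]
  have hnn : 0 ≤ Real.exp 1 * max L 0 * g s :=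
    mul_nonneg (mul_nonneg (Real.exp_pos 1).le (le_max_right _ _)) hgs.le
  calc Real.sqrt (christodoulouF f s) ≤ Real.sqrt ((Real.exp 1 * max L 0 * g s) ^ 2) :=
        Real.sqrt_le_sqrt hF
    _ = Real.exp 1 * max L 0 * g s := Real.sqrt_sq hnn

/-- **The second direction of Theorem 4.1 is not `O(g)` at `S₀`** (in every instance of the
printed input): for `γ` unbounded, no `L` and `s₀ > 0` give `|f₂(s')| ≤ L·g(s)` for all
`0 < s' ≤ s < s₀` — otherwise (4.6) would fail
(`isBoundedUnder_sqrt_christodoulouF_of_dominated`). Since exceptional data satisfy (4.4),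
`limsup h/g < ∞`, i.e. ARE `O(g)` at `S₀` in the `L²`-mean, the mechanism of Theorem 3.1
perturbs an exceptional datum only by directions strictly rougher (at `S₀`) than the datum's own
blue-shift scale `g`. [cite: Christodoulou1999instability, (4.4)–(4.6) p. 215] -/
theorem ChristodoulouInstabilityData.not_dominated_dir₂ (T : ChristodoulouInstabilityData)
    {ϑ : christodoulouDataSpace} (hΓ : T.GammaUnbounded ϑ) (L : ℝ) {s₀ : ℝ} (hs₀ : 0 < s₀) :
    ¬ ∀ s ∈ Ioo 0 s₀, ∀ s' ∈ Ioc 0 s, |(T.dir₂ ϑ : ℝ → ℝ) s'| ≤ L * T.g ϑ s := by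
  intro hdom
  have hs₁ : 0 < min s₀ 1 := lt_min hs₀ zero_lt_one
  refine T.dir₂_not_isBoundedUnder hΓ
    (isBoundedUnder_sqrt_christodoulouF_of_dominated (L := L) hs₁ ?_ ?_)
  · exact fun s hs ↦ T.g_pos hΓ s ⟨hs.1, hs.2.trans_le (min_le_right _ _)⟩
  · exact fun s hs ↦ hdom s ⟨hs.1, hs.2.trans_le (min_le_left _ _)⟩

/-- **No Hölder second direction above the blue-shift exponent.** If the profile `g` of the datum
dominates a power, `c·s^p ≤ g(s)` on `(0,1)` (`c > 0`, `p ≥ 0`; for the printed `g` this holds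
with `c = 1`, `p = 1/20`, and on a `k`-self-similar background with the exact exponent
`p_k < 1/20`), then the second direction `f₂` is not Hölder-`p` from the right at `S₀`:
`|f₂(s')| ≤ L·s'^p` on `[0,1)` is impossible. So in an admissible class of data all of which are
`C^{0,p}` at `S₀` (in particular Lipschitz, `C¹`, `C^∞` data) neither `f₁` (discontinuous,
`not_continuousAt_christodoulouDir₁`) nor `f₂` is available, and Theorem 4.1 furnishes NO
instability direction there; compare Singh, arXiv:2402.00062, Prop. 1.1–1.2 and Thm. 1
(self-similar bounds and exterior asymptotic stability at and above the threshold regularity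
`C^{1,k²/(1−k²)}` of the background scalar field). [cite: Christodoulou1999instability, (4.6) p. 215] -/
theorem ChristodoulouInstabilityData.not_holder_dir₂ (T : ChristodoulouInstabilityData)
    {ϑ : christodoulouDataSpace} (hΓ : T.GammaUnbounded ϑ) {c p : ℝ} (hc : 0 < c) (hp : 0 ≤ p)
    (hgc : ∀ s ∈ Ioo (0 : ℝ) 1, c * s ^ p ≤ T.g ϑ s) (L : ℝ) :
    ¬ ∀ s' ∈ Ico (0 : ℝ) 1, |(T.dir₂ ϑ : ℝ → ℝ) s'| ≤ L * s' ^ p := by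
  intro hH
  refine T.not_dominated_dir₂ hΓ (max L 0 / c) zero_lt_one fun s hs s' hs' ↦ ?_
  have hs'1 : s' ∈ Ico (0 : ℝ) 1 := ⟨hs'.1.le, hs'.2.trans_lt hs.2⟩
  have h1 : |(T.dir₂ ϑ : ℝ → ℝ) s'| ≤ max L 0 * s' ^ p :=
    (hH s' hs'1).trans (mul_le_mul_of_nonneg_right (le_max_left _ _)
      (Real.rpow_nonneg hs'.1.le p))
  have h2 : s' ^ p ≤ s ^ p := Real.rpow_le_rpow hs'.1.le hs'.2 hp
  have h3 : max L 0 * s ^ p ≤ max L 0 / c * T.g ϑ s := by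
    rw [div_mul_eq_mul_div, le_div_iff₀ hc, mul_assoc]
    exact mul_le_mul_of_nonneg_left (by simpa [mul_comm] using hgc s hs) (le_max_right _ _)
  exact h1.trans ((mul_le_mul_of_nonneg_left h2 (le_max_right _ _)).trans h3)

/-- **The first direction `f₁ = 𝟙_{[0,1)}` of Theorem 4.1 is discontinuous at `S₀`** (left limit
`0`, value `1`): it is a normalised `BV` datum but lies in no admissible class of data continuous
at `S₀` — "if we require higher regularity for the scalar field data—for example, even continuity
of `∂ᵥφ(−1, v)` across `{v = 0}`—the situation changes considerably" (Singh, arXiv:2402.00062,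
§1.2). [cite: Christodoulou1999instability, (4.5) p. 215] -/
theorem not_continuousAt_christodoulouDir₁ : ¬ ContinuousAt (christodoulouDir₁ : ℝ → ℝ) 0 := by
  intro h
  have h1 : Tendsto (christodoulouDir₁ : ℝ → ℝ) (𝓝[<] 0) (𝓝 1) := by
    have := h.continuousWithinAt (s := Iio 0)
    rwa [ContinuousWithinAt, christodoulouDir₁_zero] at this
  have h0 : Tendsto (christodoulouDir₁ : ℝ → ℝ) (𝓝[<] 0) (𝓝 0) := by
    refine EventuallyEq.tendsto ?_
    filter_upwards [self_mem_nhdsWithin] with s hs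
    exact christodoulouDir₁_of_neg hs
  have h10 := tendsto_nhds_unique h1 h0
  norm_num at h10

/-- **(4.4) holds for every datum with `ϑ(0) = 0` dominated by `g` at `S₀`:** if
`|ϑ(s')| ≤ L·g(s)` for `0 < s' ≤ s < s₀` then `h(s)/g(s)` is eventually bounded along `𝓝[>] 0`
(`h(s)² = s⁻¹∫₀ˢ (e^{s'}ϑ(s') − ϑ(0))² ≤ e² L² g(s)²`), so Theorem 3.1 cannot exclude such a
datum from the exceptional set. [cite: Christodoulou1999instability, Thm. 3.1 (p. 214), (4.4) p. 215] -/
theorem isBoundedUnder_christodoulouH_of_dominated {ϑ g : ℝ → ℝ} (h0 : ϑ 0 = 0) {L s₀ : ℝ}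
    (hs₀ : 0 < s₀) (hg : ∀ s ∈ Ioo 0 s₀, 0 < g s)
    (hdom : ∀ s ∈ Ioo 0 s₀, ∀ s' ∈ Ioc 0 s, |ϑ s'| ≤ L * g s) :
    IsBoundedUnder (· ≤ ·) (𝓝[>] (0 : ℝ)) (fun s ↦ christodoulouH ϑ s / g s) := by
  refine isBoundedUnder_of_eventually_le (a := Real.exp 1 * max L 0) ?_
  filter_upwards [Ioo_mem_nhdsGT (lt_min hs₀ zero_lt_one)] with s hs
  have hs1 : s ∈ Ioc (0 : ℝ) 1 := ⟨hs.1, (hs.2.trans_le (min_le_right _ _)).le⟩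
  have hss₀ : s ∈ Ioo 0 s₀ := ⟨hs.1, hs.2.trans_le (min_le_left _ _)⟩
  have hgs : 0 < g s := hg s hss₀
  have hdom' : ∀ s' ∈ Ioc 0 s, |ϑ s'| ≤ max L 0 * g s := fun s' hs' ↦
    (hdom s hss₀ s' hs').trans (mul_le_mul_of_nonneg_right (le_max_left _ _) hgs.le)
  have hnn : 0 ≤ Real.exp 1 * max L 0 * g s :=
    mul_nonneg (mul_nonneg (Real.exp_pos 1).le (le_max_right _ _)) hgs.le
  have hH : christodoulouH ϑ s ^ 2 ≤ (Real.exp 1 * max L 0 * g s) ^ 2 := by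
    rw [christodoulouH_sq hs.1.le]
    simp only [h0, sub_zero]
    exact inv_mul_setIntegral_sq_exp_mul_le hs1 hdom'
  rw [div_le_iff₀ hgs]
  exact (pow_le_pow_iff_left₀ (christodoulouH_nonneg _ _) hnn two_ne_zero).1 hH

/-- **A packaging of the printed input in which every `g`-dominated normalised datum is
exceptional.** For ANY positive profile `g` on `(0,1)` and ANY admissible second direction `f₂`
(normalised, vanishing on `(−∞,0]`, obeying (4.6) with respect to `g`) there is an instance of
`ChristodoulouInstabilityData` with this `g` and this `f₂` (and `I ≡ 0`, `γ` unbounded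
everywhere) whose exceptional set contains every normalised datum with `ϑ(0) = 0` that is
dominated by `g` at `S₀`: take `E = {ϑ normalised | ϑ(0) = lim I = 0 ∧ limsup h/g < ∞}`, the
largest set compatible with Theorems 2.1 and 3.1. Theorem 4.1 holds for it
(`nakedSingularityInstability`), yet whole linear classes of continuous-at-`S₀` data lie inside
`E`. This is the formal content of the audit finding that the fields of the structure — the
entire printed input of §4 — constrain `E` only through the ROUGH directions `f₁`, `f₂`.
[cite: Christodoulou1999instability, §4 pp. 214–216] -/
theorem exists_instabilityData_forall_dominated_mem
    (g : ℝ → ℝ) (hg : ∀ s ∈ Ioo (0 : ℝ) 1, 0 < g s)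
    (f₂ : christodoulouDataSpace) (hf₂ : f₂ ∈ rightContinuousData)
    (hf₂0 : ∀ s : ℝ, s ≤ 0 → (f₂ : ℝ → ℝ) s = 0)
    (h46 : ¬ IsBoundedUnder (· ≤ ·) (𝓝[>] (0 : ℝ))
      (fun s ↦ Real.sqrt (christodoulouF f₂ s) / g s)) :
    ∃ T : ChristodoulouInstabilityData, (∀ ϑ, T.g ϑ = g) ∧ (∀ ϑ, T.dir₂ ϑ = f₂) ∧
      ∀ ϑ : christodoulouDataSpace, ϑ ∈ rightContinuousData → (ϑ : ℝ → ℝ) 0 = 0 →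
        (∃ L, ∀ s ∈ Ioo (0 : ℝ) 1, ∀ s' ∈ Ioc 0 s, |(ϑ : ℝ → ℝ) s'| ≤ L * g s) → ϑ ∈ T.E := by
  refine ⟨{ E := {ϑ | ϑ ∈ rightContinuousData ∧ (ϑ : ℝ → ℝ) 0 = 0 ∧
              IsBoundedUnder (· ≤ ·) (𝓝[>] (0 : ℝ)) (fun s ↦ christodoulouH ϑ s / g s)}
            GammaUnbounded := fun _ ↦ True
            I := fun _ _ ↦ 0
            g := fun _ ↦ g
            dir₂ := fun _ ↦ f₂
            subset_rightContinuousData := fun ϑ hϑ ↦ hϑ.1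
            gammaUnbounded_congr := fun _ _ _ ↦ Iff.rfl
            I_congr := fun _ _ _ ↦ rfl
            g_congr := fun _ _ _ ↦ rfl
            dir₂_congr := fun _ _ _ ↦ rfl
            gammaUnbounded_of_mem := fun _ _ ↦ trivial
            g_pos := fun _ _ ↦ hg
            dir₂_mem := fun _ ↦ hf₂
            dir₂_apply_of_nonpos := fun _ s hs ↦ hf₂0 s hs
            dir₂_not_isBoundedUnder := fun _ _ ↦ h46
            notMem_of_not_tendsto := ?_
            notMem_of_not_isBoundedUnder := ?_ }, fun _ ↦ rfl, fun _ ↦ rfl, ?_⟩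
  · intro ϑ _ _ hI hE
    apply hI
    have h0 : (ϑ : ℝ → ℝ) 0 = 0 := hE.2.1
    rw [h0]
    exact tendsto_const_nhds
  · intro ϑ _ _ _ hb hE
    exact hb hE.2.2
  · rintro ϑ hϑ h0 ⟨L, hL⟩
    exact ⟨hϑ, h0, isBoundedUnder_christodoulouH_of_dominated h0 zero_lt_one hg hL⟩

/-! #### A concrete admissible pair `(g, f₂) = (s, √s·𝟙_{[0,1)})` and the Lipschitz-at-`S₀` class -/

/-- The direction `s ↦ √s · 𝟙_{[0,1)}(s)`: a normalised `BV ∩ L¹` datum, vanishing on `(−∞, 0]`,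
continuous (Hölder-`½`) at `S₀`, obeying (4.6) with respect to the profile `g(s) = s`
(`F(s) ≥ s/4`). It witnesses that the hypotheses of
`exists_instabilityData_forall_dominated_mem` are satisfiable. [folklore] -/
def christodoulouDirSqrt : christodoulouDataSpace :=
  ⟨fun s ↦ Real.sqrt s * (Ico (0 : ℝ) 1).indicator 1 s, by
    have heq : (fun s ↦ Real.sqrt s * (Ico (0 : ℝ) 1).indicator 1 s) =
        (fun s ↦ Real.sqrt (min s 1)) + (-1 : ℝ) • (Ici (1 : ℝ)).indicator (1 : ℝ → ℝ) := by
      funext s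
      simp only [Pi.add_apply, Pi.smul_apply, smul_eq_mul]
      by_cases h1 : s < 1
      · have hIci : s ∉ Ici (1 : ℝ) := fun h ↦ not_le.2 h1 h
        rw [indicator_of_notMem hIci, min_eq_left h1.le]
        by_cases h0 : 0 ≤ s
        · rw [indicator_of_mem (show s ∈ Ico (0 : ℝ) 1 from ⟨h0, h1⟩)]
          simp
        · rw [indicator_of_notMem (fun h : s ∈ Ico (0 : ℝ) 1 ↦ h0 h.1),
            Real.sqrt_eq_zero'.2 (not_le.1 h0).le]
          simp
      · have h1' : 1 ≤ s := not_lt.1 h1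
        rw [indicator_of_notMem (fun h : s ∈ Ico (0 : ℝ) 1 ↦ h1 h.2),
          indicator_of_mem (show s ∈ Ici (1 : ℝ) from h1'), min_eq_right h1']
        simp
    rw [heq]
    refine BoundedVariationOn.add ?_ ((boundedVariationOn_indicator_Ici_one 1).const_smul (-1 : ℝ))
    refine MonotoneOn.boundedVariationOn (C := 1) (fun x _ y _ hxy ↦ ?_) fun x _ ↦ ?_
    · exact Real.sqrt_le_sqrt (min_le_min_right 1 hxy)
    · rw [abs_of_nonneg (Real.sqrt_nonneg _)]
      calc Real.sqrt (min x 1) ≤ Real.sqrt 1 := Real.sqrt_le_sqrt (min_le_right _ _)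
        _ = 1 := Real.sqrt_one, by
    have heq : (fun s ↦ Real.sqrt s * (Ico (0 : ℝ) 1).indicator 1 s) =
        (Ico (0 : ℝ) 1).indicator Real.sqrt := by
      funext s
      by_cases hs : s ∈ Ico (0 : ℝ) 1
      · simp [indicator_of_mem hs]
      · simp [indicator_of_notMem hs]
    rw [heq, integrable_indicator_iff measurableSet_Ico]
    exact (Real.continuous_sqrt.integrableOn_Icc (a := 0) (b := 1)).mono_set Ico_subset_Icc_self⟩

/-- Unfolding lemma for `christodoulouDirSqrt`. [folklore] -/
@[simp] lemma christodoulouDirSqrt_apply (s : ℝ) :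
    (christodoulouDirSqrt : ℝ → ℝ) s = Real.sqrt s * (Ico (0 : ℝ) 1).indicator 1 s := rfl

/-- On `[0, 1)` the direction is `√s`. [folklore] -/
lemma christodoulouDirSqrt_apply_of_mem {s : ℝ} (hs : s ∈ Ico (0 : ℝ) 1) :
    (christodoulouDirSqrt : ℝ → ℝ) s = Real.sqrt s := by
  simp [indicator_of_mem hs]

/-- The direction vanishes on `(−∞, 0]`. [folklore] -/
lemma christodoulouDirSqrt_apply_of_nonpos {s : ℝ} (hs : s ≤ 0) :
    (christodoulouDirSqrt : ℝ → ℝ) s = 0 := by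
  simp [Real.sqrt_eq_zero'.2 hs]

/-- The direction is a normalised (right-continuous) datum. [folklore] -/
lemma christodoulouDirSqrt_mem : christodoulouDirSqrt ∈ rightContinuousData := fun x ↦
  (Real.continuous_sqrt.continuousWithinAt).mul (continuousWithinAt_Ici_indicator_Ico_one 0 1 x)

/-- `F(s) ≥ s/4` for the direction `√s·𝟙_{[0,1)}` and `s ∈ (0,1)`
(`F(s) = s⁻¹∫₀ˢ e^{2s'} s' ds' ≥ s⁻¹ ∫_{(s/2, s]} s/2 ds'`). [folklore] -/
lemma christodoulouF_dirSqrt_ge {s : ℝ} (hs : s ∈ Ioo (0 : ℝ) 1) :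
    s / 4 ≤ christodoulouF christodoulouDirSqrt s := by
  have hs0 : 0 < s := hs.1
  rw [christodoulouF_eq hs0.le]
  set Φ : ℝ → ℝ := fun s' ↦ Real.exp (2 * s') * (christodoulouDirSqrt : ℝ → ℝ) s' ^ 2 with hΦ
  -- on `(0, s]` the integrand is `e^{2s'} s'`
  have hΦeq : ∀ s' ∈ Ioc (0 : ℝ) s, Φ s' = Real.exp (2 * s') * s' := by
    intro s' hs'
    have hs'1 : s' ∈ Ico (0 : ℝ) 1 := ⟨hs'.1.le, hs'.2.trans_lt hs.2⟩
    simp only [hΦ, christodoulouDirSqrt_apply_of_mem hs'1, Real.sq_sqrt hs'.1.le]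
  have hΦnn : ∀ s' ∈ Ioc (0 : ℝ) s, 0 ≤ Φ s' := fun s' hs' ↦ by
    rw [hΦeq s' hs']; exact mul_nonneg (Real.exp_pos _).le hs'.1.le
  have hΦle : ∀ s' ∈ Ioc (0 : ℝ) s, ‖Φ s'‖ ≤ Real.exp 2 := by
    intro s' hs'
    rw [Real.norm_eq_abs, abs_of_nonneg (hΦnn s' hs'), hΦeq s' hs']
    have h1 : Real.exp (2 * s') ≤ Real.exp 2 :=
      Real.exp_le_exp.2 (by linarith [hs'.2, hs.2])
    calc Real.exp (2 * s') * s' ≤ Real.exp 2 * 1 :=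
          mul_le_mul h1 (hs'.2.trans hs.2.le) hs'.1.le (Real.exp_pos 2).le
      _ = Real.exp 2 := mul_one _
  have hmeas : AEStronglyMeasurable Φ volume := by
    have h2 : AEStronglyMeasurable (christodoulouDirSqrt : ℝ → ℝ) volume :=
      christodoulouDirSqrt.2.2.aestronglyMeasurable
    simp only [hΦ]
    exact ((Real.continuous_exp.comp (continuous_const.mul continuous_id)).aestronglyMeasurable).mul
      (h2.pow 2)
  have hint : IntegrableOn Φ (Ioc 0 s) := by
    refine Measure.integrableOn_of_bounded (M := Real.exp 2) measure_Ioc_lt_top.ne hmeas ?_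
    rw [ae_restrict_iff' measurableSet_Ioc]
    exact ae_of_all _ hΦle
  have hsub : ∫ s' in Ioc (s / 2) s, Φ s' ≤ ∫ s' in Ioc 0 s, Φ s' := by
    refine setIntegral_mono_set hint ?_ (ae_of_all _ (Ioc_subset_Ioc_left (by linarith)))
    rw [EventuallyLE, ae_restrict_iff' measurableSet_Ioc]
    exact ae_of_all _ hΦnn
  have hlow : (volume : Measure ℝ).real (Ioc (s / 2) s) • (s / 2) ≤ ∫ s' in Ioc (s / 2) s, Φ s' := by
    refine setIntegral_ge_of_const_le measurableSet_Ioc measure_Ioc_lt_top.ne ?_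
      (hint.mono_set (Ioc_subset_Ioc_left (by linarith)))
    intro s' hs'
    have hs'' : s' ∈ Ioc (0 : ℝ) s := ⟨by linarith [hs'.1], hs'.2⟩
    rw [hΦeq s' hs'']
    have h1 : 1 ≤ Real.exp (2 * s') := by
      have := Real.add_one_le_exp (2 * s'); linarith [hs''.1]
    calc s / 2 ≤ 1 * s' := by linarith [hs'.1]
      _ ≤ Real.exp (2 * s') * s' := mul_le_mul_of_nonneg_right h1 hs''.1.le
  rw [Real.volume_real_Ioc_of_le (by linarith), smul_eq_mul] at hlow
  have hchain : s / 2 * (s / 2) ≤ ∫ s' in Ioc 0 s, Φ s' := by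
    have : (s - s / 2) * (s / 2) = s / 2 * (s / 2) := by ring
    linarith
  calc s / 4 = s⁻¹ * (s / 2 * (s / 2)) := by field_simp; ring
    _ ≤ s⁻¹ * ∫ s' in Ioc 0 s, Φ s' := mul_le_mul_of_nonneg_left hchain (inv_nonneg.2 hs0.le)

/-- **(4.6) for the pair `(g, f₂) = (s, √s·𝟙_{[0,1)})`:** `√F(s)/s ≥ 1/(2√s)` is not eventually
bounded along `𝓝[>] 0`. [folklore] -/
lemma not_isBoundedUnder_dirSqrt :
    ¬ IsBoundedUnder (· ≤ ·) (𝓝[>] (0 : ℝ))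
      (fun s ↦ Real.sqrt (christodoulouF christodoulouDirSqrt s) / s) := by
  rintro ⟨B, hB⟩
  have hBe : ∀ᶠ s in 𝓝[>] (0 : ℝ),
      Real.sqrt (christodoulouF christodoulouDirSqrt s) / s ≤ B := hB
  set B' : ℝ := max B 1 with hB'
  have hB'pos : 0 < B' := lt_of_lt_of_le zero_lt_one (le_max_right _ _)
  have hε : 0 < 1 / (8 * B' ^ 2) := by positivity
  have hIoo : ∀ᶠ s in 𝓝[>] (0 : ℝ), s ∈ Ioo (0 : ℝ) 1 := Ioo_mem_nhdsGT zero_lt_one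
  have hIooε : ∀ᶠ s in 𝓝[>] (0 : ℝ), s ∈ Ioo (0 : ℝ) (1 / (8 * B' ^ 2)) := Ioo_mem_nhdsGT hε
  obtain ⟨s, hsB, hs1, hsε⟩ := (hBe.and (hIoo.and hIooε)).exists
  have hs0 : 0 < s := hs1.1
  have hF := christodoulouF_dirSqrt_ge hs1
  have h1 : Real.sqrt (christodoulouF christodoulouDirSqrt s) ≤ B' * s := by
    rw [div_le_iff₀ hs0] at hsB
    exact hsB.trans (mul_le_mul_of_nonneg_right (le_max_left _ _) hs0.le)
  have h2 : christodoulouF christodoulouDirSqrt s ≤ (B' * s) ^ 2 :=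
    (Real.sqrt_le_left (by positivity)).1 h1
  have h3 : s / 4 ≤ B' ^ 2 * s * s := by nlinarith
  have h4 : 1 / 4 ≤ B' ^ 2 * s := by
    have h3' : 1 / 4 * s ≤ B' ^ 2 * s * s := by linarith
    exact le_of_mul_le_mul_right h3' hs0
  have h5 : s < 1 / (8 * B' ^ 2) := hsε.2
  have h6 : B' ^ 2 * s < 1 / 8 := by
    rw [lt_div_iff₀ (by positivity)] at h5
    linarith
  linarith

/-- **The class of normalised data that are Lipschitz at `S₀` from the outside** (and vanish
there): right-continuous `BV ∩ L¹` data with `|ϑ(s)| ≤ L·s` on `[0, 1)` for some `L`. A real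
linear subspace of `rightContinuousData` containing e.g. all `C¹` data vanishing on `(−∞, 0]`;
it excludes both instability directions of Theorem 4.1 (`f₁` is discontinuous at `S₀`, and no
Lipschitz `f₂` obeys (4.6) when `g ≥ s`). [folklore] -/
def lipschitzConeData : Submodule ℝ christodoulouDataSpace where
  carrier := {ϑ | ϑ ∈ rightContinuousData ∧ ∃ L : ℝ, ∀ s ∈ Ico (0 : ℝ) 1, |(ϑ : ℝ → ℝ) s| ≤ L * s}
  add_mem' := by
    rintro a b ⟨ha, La, hLa⟩ ⟨hb, Lb, hLb⟩
    refine ⟨rightContinuousData.add_mem ha hb, La + Lb, fun s hs ↦ ?_⟩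
    simp only [Submodule.coe_add, Pi.add_apply]
    calc |(a : ℝ → ℝ) s + (b : ℝ → ℝ) s| ≤ |(a : ℝ → ℝ) s| + |(b : ℝ → ℝ) s| := abs_add_le _ _
      _ ≤ La * s + Lb * s := add_le_add (hLa s hs) (hLb s hs)
      _ = (La + Lb) * s := by ring
  zero_mem' := ⟨rightContinuousData.zero_mem, 0, fun s _ ↦ by simp⟩
  smul_mem' := by
    rintro c a ⟨ha, La, hLa⟩
    refine ⟨rightContinuousData.smul_mem c ha, |c| * La, fun s hs ↦ ?_⟩
    simp only [Submodule.coe_smul, Pi.smul_apply, smul_eq_mul, abs_mul]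
    calc |c| * |(a : ℝ → ℝ) s| ≤ |c| * (La * s) :=
          mul_le_mul_of_nonneg_left (hLa s hs) (abs_nonneg c)
      _ = |c| * La * s := by ring

/-- Membership in the Lipschitz-at-`S₀` class. [folklore] -/
lemma mem_lipschitzConeData {ϑ : christodoulouDataSpace} :
    ϑ ∈ lipschitzConeData ↔
      ϑ ∈ rightContinuousData ∧ ∃ L : ℝ, ∀ s ∈ Ico (0 : ℝ) 1, |(ϑ : ℝ → ℝ) s| ≤ L * s := Iff.rfl

/-- The Lipschitz-at-`S₀` class consists of normalised data. [folklore] -/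
lemma lipschitzConeData_le : lipschitzConeData ≤ rightContinuousData := fun _ h ↦ h.1

/-- The Lipschitz-at-`S₀` class is nonzero (it contains `𝟙_{[1,2)}`). [folklore] -/
lemma lipschitzConeData_ne_bot : lipschitzConeData ≠ ⊥ := by
  rw [Submodule.ne_bot_iff]
  refine ⟨⟨(Ico 1 2).indicator 1, boundedVariationOn_indicator_Ico_one one_le_two,
    integrable_indicator_Ico_one 1 2⟩, ⟨fun x ↦ continuousWithinAt_Ici_indicator_Ico_one 1 2 x,
    0, fun s hs ↦ ?_⟩, fun h ↦ ?_⟩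
  · have : s ∉ Ico (1 : ℝ) 2 := fun h ↦ not_lt.2 h.1 hs.2
    simp [indicator_of_notMem this]
  · have h1 := congr_arg (fun ψ : christodoulouDataSpace ↦ (ψ : ℝ → ℝ) 1) h
    simp at h1

/-- **NARROWED BARRIER (audit D-0021, 2026-08-15): Christodoulou's instability theorem is a
statement about ROUGH perturbations, and its positive codimension does not descend to smoother
admissible classes.** Conjunction of: (A) Theorem 4.1 for every instance of the printed input
(the original barrier `nakedSingularityInstability`, unchanged: linear codimension `≥ 2` of `E`
inside the normalised `BV ∩ L¹` class); (B) the two directions are confined to low regularity at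
the sphere `S₀ = C₀⁻ ∩ C₀⁺` — `f₁` is discontinuous there, and in every instance the second
direction `f₂` of a datum with unbounded `γ` is never `O(g)` at `S₀` (`not_dominated_dir₂`;
with the printed `g ≥ s^{1/20}`: never Hölder-`1/20`, `not_holder_dir₂`); (C) NON-DESCENT —
there is an instance of the printed input (profile `g(s) = s`, direction `f₂ = √s·𝟙_{[0,1)}`,
`E` = all normalised data with `ϑ(0) = lim I` and `limsup h/g < ∞`) for which Theorem 4.1 holds
and yet the whole nonzero linear class `lipschitzConeData` of normalised data Lipschitz at `S₀`
lies INSIDE `E`: relative to that class `E` has codimension `0` (`¬ HasLinearCodimAtLeast … 1`)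
and is relatively open — indeed everything — in every topology (`HasOpenSubset`), the exact shape
the barrier's clause (α) forbids relative to `BV`. Reading: the technique classes
`open-set-of-counterexamples` / `stable-naked-singularity` are blocked in print only in data
topologies coarse enough to contain `f₁` or an `f₂` obeying (4.6) (BV, AC; Hölder classes
strictly below the background threshold `C^{1,k²/(1−k²)}` by [cite: Shlapentokhrothman2025, §2.4 p. 390]);
in any class of data Hölder-continuous at `S₀` above that threshold — Lipschitz, `C¹`, the `C^∞`
class `IsAdmissibleWCCData` of the tree's `WeakCosmicCensorship`/`NegWeakCosmicCensorship`, or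
weighted-Sobolev `H^s` topologies with `s` large — NO instability theorem is in print, linear
waves obey self-similar bounds and the exterior region is nonlinearly asymptotically stable
(Singh, arXiv:2402.00062, Thm. 1, Prop. 1.1–1.2, §1.4: "the blue-shift heuristic … does not hold
… with data in any topology that is of the form `C^{1,β}([−1, 0])`, `β > 0`"), "these results
are consistent with the `k`-self similar singularities being nonlinearly stable to sufficiently
regular perturbations!" [cite: Shlapentokhrothman2025, §2.5 pp. 390–391], and "In the smooth
class, both the question of the formation of naked singularities and the question of their
genericity remain open" (Cicortas–Kehle, arXiv:2412.09540 = ARMA (2026), §1.5); and the physical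
counterpart of (C) is in print — exterior perturbations of a `k`-self-similar datum vanishing linearly at
`S₀` and small in a weighted `C¹` norm again develop an incomplete `𝓘⁺`
[cite: Singh2022, Thm. 5 with data (3.33)], so relative to that Lipschitz-at-`S₀` class the exceptional
set has nonempty relative interior; likewise the
genericity-blind clause (β) is established only for classes containing the `C^{1,γ}`-across-a-cone
examples — smooth (even `C²`) naked-singularity data are open for the scalar-field model
[cite: Shlapentokhrothman2025, §2.3 p. 389] and for vacuum [cite: Shlapentokhrothman2025, §4.5 p. 405].
[cite: Christodoulou1999instability, Thm. 4.1 (p. 216), (4.4)–(4.6) p. 215] -/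
theorem nakedSingularityInstabilityNarrow :
    (∀ T : ChristodoulouInstabilityData,
        HasLinearCodimAtLeast (rightContinuousData : Set christodoulouDataSpace) T.E 2) ∧
    ¬ ContinuousAt (christodoulouDir₁ : ℝ → ℝ) 0 ∧
    (∀ T : ChristodoulouInstabilityData, ∀ ϑ : christodoulouDataSpace, T.GammaUnbounded ϑ →
        ∀ L s₀ : ℝ, 0 < s₀ →
          ¬ ∀ s ∈ Ioo 0 s₀, ∀ s' ∈ Ioc 0 s, |(T.dir₂ ϑ : ℝ → ℝ) s'| ≤ L * T.g ϑ s) ∧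
    ∃ T : ChristodoulouInstabilityData,
      (∀ ϑ, T.g ϑ = fun s ↦ s) ∧ (∀ ϑ, T.dir₂ ϑ = christodoulouDirSqrt) ∧
      (lipschitzConeData : Set christodoulouDataSpace) ⊆ T.E ∧
      ¬ HasLinearCodimAtLeast (lipschitzConeData : Set christodoulouDataSpace)
          (T.E ∩ lipschitzConeData) 1 ∧
      ∀ t : TopologicalSpace christodoulouDataSpace,
        @HasOpenSubset lipschitzConeData (@instTopologicalSpaceSubtype christodoulouDataSpace _ t)
          {d | (d : christodoulouDataSpace) ∈ T.E} := by
  refine ⟨fun T ↦ T.hasLinearCodimAtLeast_two, not_continuousAt_christodoulouDir₁,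
    fun T ϑ hΓ L s₀ hs₀ ↦ T.not_dominated_dir₂ hΓ L hs₀, ?_⟩
  obtain ⟨T, hTg, hTd, hTE⟩ := exists_instabilityData_forall_dominated_mem (fun s ↦ s)
    (fun s hs ↦ hs.1) christodoulouDirSqrt christodoulouDirSqrt_mem
    (fun s hs ↦ christodoulouDirSqrt_apply_of_nonpos hs) not_isBoundedUnder_dirSqrt
  have hsub : (lipschitzConeData : Set christodoulouDataSpace) ⊆ T.E := by
    rintro ϑ ⟨hϑ, L, hL⟩
    have h0 : (ϑ : ℝ → ℝ) 0 = 0 := by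
      have := hL 0 ⟨le_rfl, zero_lt_one⟩
      simpa using this
    refine hTE ϑ hϑ h0 ⟨max L 0, fun s hs s' hs' ↦ ?_⟩
    have hs'1 : s' ∈ Ico (0 : ℝ) 1 := ⟨hs'.1.le, hs'.2.trans_lt hs.2⟩
    calc |(ϑ : ℝ → ℝ) s'| ≤ L * s' := hL s' hs'1
      _ ≤ max L 0 * s' := mul_le_mul_of_nonneg_right (le_max_left _ _) hs'.1.le
      _ ≤ max L 0 * s := mul_le_mul_of_nonneg_left hs'.2 (le_max_right _ _)
  refine ⟨T, hTg, hTd, hsub, fun hcod ↦ ?_, fun t ↦ ?_⟩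
  · have h0 : (0 : christodoulouDataSpace) ∈ T.E ∩ (lipschitzConeData : Set christodoulouDataSpace) :=
      ⟨hsub lipschitzConeData.zero_mem, lipschitzConeData.zero_mem⟩
    obtain ⟨f, -, hD, hE⟩ := hcod 0 h0
    have hne : (fun _ : Fin 1 ↦ (1 : ℝ)) ≠ 0 := fun h ↦ one_ne_zero (congr_fun h 0)
    exact hE _ hne ⟨hsub (hD _), hD _⟩
  · letI := t
    refine ⟨0, ?_⟩
    have huniv : {d : lipschitzConeData | (d : christodoulouDataSpace) ∈ T.E} = univ :=
      eq_univ_of_forall fun d ↦ hsub d.2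
    rw [huniv, interior_univ]
    exact mem_univ _

end Literature.Barriers.FinalStateConjecture

end
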